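import Summits.Langlands.Langlands.Theses.IrreducibilityBySelfDuality
import Literature.NumberTheory.Automorphic.SelfdualGL3AdjointLiftProofs
import Literature.NumberTheory.Automorphic.ReciprocityGLnRankOneProofs
import Literature.NumberTheory.Automorphic.AutomorphicRepCentralCharacter
import Literature.NumberTheory.GaloisRepresentations.HeckeCharacterWeakApproximation
import Literature.NumberTheory.Automorphic.GLOneOfHeckeCharacterBJ
import Literature.NumberTheory.Automorphic.ArchParameterTwistNorm
import Literature.NumberTheory.Automorphic.AutomorphicRepsGLOneArchParameter
import Literature.NumberTheory.Automorphic.ArchParameterUnique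
import Literature.NumberTheory.Automorphic.GLOneArchParameterClauses
import Literature.NumberTheory.Automorphic.AutomorphicRepsGLOneHeckeCharacter

/-!
# Disproof of `RegularAdjointLiftCM` — standing adversary work file (crux `stmt-Langlands-13617`)

Crux: `Summit.Langlands.Langlands.Theses.IrreducibilityBySelfDuality.RegularAdjointLiftCM`
(route `route-Langlands-IrreducibilityBySelfDuality`, rank 2; `cdisprove` seat gen 1 / cycle 1,
gen 2 / cycle 2 and gen 3 / cycle 3, 2026-08-16).  Every `theorem` below is sorry-free (`lean check` rc 0,
axioms ⊆ {propext, Classical.choice, Quot.sound}); prose lives in docstrings.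

## VERDICT (cycles 1–3): resists.  (Cycle-2 additions: §8–§10; cycle-3 additions: §11–§12 below — the crux is
EQUIVALENT to its sibling `RegularTwistCM` modulo the inputs, and the picked line's last stub `HermitianSymmetry`
is analysed: true on paper, its `c = 0` strengthening refuted in Lean.  Landed negative lemmas:
`Theorems/RegularAdjointLiftCM/Negative/KillCriterion.lean` (gen 1), `…/Negative/CentreCube.lean` (gen 2, p76784,
ACCEPTED commit ec8d499571b4: §8–§9 importable as `Summit.Langlands.Langlands.Theorems.RegularAdjointLiftCM.Negative.*`);
gen 3 proposals: `…/Negative/SiblingEquivalence.lean` (§11), `…/Negative/HermitianShift.lean` (§12) — see NOTES / ledger.)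

STATE OF THE PICKED LINE `nu-cubed-central-character` (read 2026-08-16, cycle 3): stubs 1–2 are LANDED
(`Theorems/IrreducibilityBySelfDualityRegularAdjointLiftCMCentralCharacterInfinityType.lean`,
`…CubeRootAlgebraic.lean`); the one open stub is the reshaped `stub_hermitianSymmetry` (§12).  Hence, kernel-checked
chain: `HermitianSymmetry ⟹ PurityGL3 ⟹ NuAlgebraic ⟹ NuCubeAlgebraic`-shape input, and by §10–§11
**crux ⟺ RegularTwistCM** given Thm A + multiplicity one for SL(2) + that input.  A disprover of EITHER crux now
serves both; this seat found no kill of `HermitianSymmetry` (all constructible data — GL(1) lines, the tree's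
`π_log` — satisfy it) and records why (§12).

* No counter-model can be TYPED: every hypothesis needs a genuine `CuspidalAutomorphicRepData 3 K _`
  (a non-zero cusp form on `GL₃`) that is regular algebraic and essentially self-dual, and the crux is
  an implication `SelfdualGL3AdjointLift → CMStep` whose antecedent (Ramakrishnan 2014 Thm A at
  Satake level) is itself unprovable in the tree — so a Lean refutation would have to PROVE Thm A and
  exhibit such a `π` (§1, `regularAdjointLiftCM_iff`, `of_not_selfdualGL3AdjointLift`).
* On paper the CM step is TRUE (§6 docstring: the unit computation in full, including the index-2
  passage to squares of units and why purity / unitarity is what makes the modulus exponents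
  parallel); the only field-theoretic input is `[𝓞_K^× : μ_K · 𝓞_{K⁺}^×] ∈ {1, 2}`, which is
  MATHLIB: `NumberField.IsCMField.indexRealUnits_eq_one_or_two` (+ `IsCMField.realUnits`,
  `units_rank_eq_units_rank`).  Provers: that lemma is the formal home of the "CM parity freedom".

## Findings (index; `L` = Lean theorem below, `P` = paper, in docstrings)

* §1 `L` ANATOMY.  `RegularAdjointLiftCM ↔ (SelfdualGL3AdjointLift → CMStep)` is `Iff.rfl`
  (`regularAdjointLiftCM_iff`); hence `¬ SelfdualGL3AdjointLift → RegularAdjointLiftCM`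
  (`of_not_selfdualGL3AdjointLift`: the crux is only as strong as its CM half; were the input item
  stmt-Langlands-13621 ever refuted, this item closes trivially) and `CMStep → RegularAdjointLiftCM`.
  The CM half is spelled with four named predicates (`EssSelfDualSatake`, `NonDihedral`, `AdRel`,
  `quadSign`) that unfold DEFINITIONALLY to the route text — planners may quote them.
* §2 `L` PREFIX IS INSTANTIABLE, LEVELS ARE IRRELEVANT.  `ℚ(ζ₃)` is a CM field in Mathlib's sense
  (`isCMField_cyclotomicField_three`) and the level witnesses exist
  (`isCompact_glFiniteIntegralLevel_holds`), so the `∀ K, IsCMField K → ∀ h1 hcpt₂ hcpt` prefix is not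
  vacuous (`prefix_inhabited`); and `CMStep ↔ CMStepCanonical` (`cmStep_iff_canonical`): the three
  level witnesses are proof-irrelevant, a prover may fix them to the `_holds` witnesses.
* §3 `L` SATAKE ALGEBRA OF THE CONCLUSION — the Satake half of the CM step is FREE:
  `adParams (β.map (c * ·)) = adParams β` (`adParams_map_mul`, new; `Ad` is blind to twists), hence
  `AdRel π σ₀ ν → IsSatakeTwistOf σ σ₀ χ → AdRel π σ ν` (`adRel_of_isSatakeTwistOf`) and
  `NonDihedral σ₀ → IsSatakeTwistOf σ σ₀ χ → NonDihedral σ` (`nonDihedral_of_isSatakeTwistOf`):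
  of the four conjuncts of the conclusion only `σ.1.IsRegularAlgebraic` is NOT invariant under a.e.
  Satake twists of `σ`.  Consequently (`cmStep_of_regularTwistCM`)
  `SelfdualGL3AdjointLift → RegularTwistCM → NuAlgebraicInput → CMStep`: modulo the two sibling
  items the crux is EXACTLY the archimedean statement "ν is algebraic" (`NuAlgebraicInput`, the
  planner's input (c): `ν_w` is the middle exponent of `π_w`).  Also `essSelfDual_of_adRel`: the
  conclusion re-implies the hypothesis SHAPE with multiplier `d_v⁻²` (no hidden inconsistency between
  hypothesis and conclusion; `η` and `ν⁻²` agree only up to an a.e. self-twist multiplier of `t_π`,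
  a cube root of unity — harmless, `∃ d` absorbs it).
* §4 `L`+`P` LOAD-BEARING HYPOTHESES, as typed variants with the trivial implications INTO the crux
  (`cmStep_of_anyField`, `cmStep_of_totallyComplex`, `cmStep_of_cAlgebraic`) and their paper status:
  `CMStepAnyField` FALSE (non-paritious Hilbert newforms over a real quadratic field: `Ad(σ₀)` is
  regular algebraic self-dual cuspidal on `GL₃`, its `GL₂`-descent is unique up to twist and no twist
  is algebraic — Weil: algebraic Hecke characters of a totally real field are `‖·‖ⁿ ×` finite order);
  `CMStepTotallyComplex` EXPECTED FALSE modulo the existence of a mixed-parity `σ₀` over a non-CM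
  totally imaginary field (Patrikis 2019 = arXiv:1207.6724, Lemma 2.1.5, read p. 19: unitary type-A
  extensions exist iff the angular residues factor through the maximal CM subfield, so parities of the
  re-twist cannot be chosen independently at complex places over one place of `K_cm`);
  `CMStepCAlgebraic` (regularity of `π` dropped)
  FALSE: `π = Ad(BC_{K/ℚ} f)` for an exotic weight-one newform `f` (tetrahedral type, e.g. level 133)
  is C-algebraic, cuspidal, self-dual, IRREGULAR, and no twist of a parallel-weight-one `σ₀` is
  regular.  So any proof must USE `IsCMField` and `IsRegularAlgebraic` — consistent with refuters
  g45-26 / g45-10; new here: the exact typed variants and the CM ⊂ totally-complex distinction.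
* §4b `L` THE KILL CRITERION FORMALISED.  Multiplicity one for `SL(2)` (tree fact
  `Ramakrishnan2000_multiplicityOneSL2`, via the PROVED `unique_up_to_twist`) + the GL(1) dictionary
  (`exists_heckeCharacter_satake_eq`, proved here from tree lemmas) give `no_regular_descent`: one
  descent `σ₀` of `π` with NO regular algebraic Satake twist forbids every `(σ, ν)` with `σ` RA and
  `AdRel π σ ν`.  Corollaries: `cmStepAnyField_false_of`, `cmStepCAlgebraic_false_of` (the §4
  mutations as kernel-checked implications from their paper witnesses), and `kill_criterion :
  mult-one → Thm A → (CM witness) → ¬ RegularAdjointLiftCM` — given the two inputs, refuting the crux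
  is EQUIVALENT to exhibiting a regular algebraic essentially self-dual cuspidal `π` over a CM field
  with a descent admitting no RA Satake twist (`descent_has_regular_twist` is the contrapositive).
  §6 says why that witness should not exist; NOT filed `--negative-modulo` (hypothesis believed empty).
* §5 `P` FALSE STRENGTHENINGS OF THE CONCLUSION (do not re-propose): (S1) `ν` trivial — false
  (`π = Ad(σ) ⊗ μ`, `μ` algebraic of infinity type `z¹ z̄⁰`, which EXISTS over CM `K`, is regular
  algebraic, cuspidal, essentially self-dual, and `Ad(σ) ⊗ μ ≅ Ad(σ')` would force `μ⁶ = 1`);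
  (S2) `σ` unique — false (integral algebraic twists); (S3) "`σ` regular algebraic with FINITE-ORDER
  central character" (Ramakrishnan's normalisation `ω_π` finite, §4 p. 783 of the 2014 paper) — false
  whenever the weight `a_w = s₁ - s₂` is EVEN at some place (then `RA` forces a `‖·‖^{1/2}`-type shift
  and `ω_σ` has infinite order): a prover transcribing Ramakrishnan's §4 verbatim inherits this
  normalisation and must drop it; (S4) `χ` (the re-twist) of finite order, i.e. "σ₀ itself is RA" —
  false even over CM (that is crux RegularTwistCM's raison d'être).
* §6 `P` WHY IT RESISTS — the CM unit computation, written out (docstring of `cmStep_paper_status`).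
* §7 TARGETS: cycle 1–2 none; cycle 3: the picked line's stubs — two landed, the third (`HermitianSymmetry`) in §12.

* §8 `L` (cycle 2) THE CENTRE OF THE CONCLUSION, kernel-checked from PROVED tree theorems.  At
  Satake level `AdRel π σ ν ⇒ det t_{π,v} = d_v³` a.e. (`adRel_cube`) and `EssSelfDualSatake π η ⇒
  e_v³ (det t_{π,v})² = 1` a.e. (`essSelfDual_cube`); hence `ν` is pinned by `π` up to a.e. cube roots
  of unity (`adRel_cube_unique`) and `(e_v d_v²)³ = 1` (`adRel_essSelfDual_cube`: Thm A's `d² e = 1` is a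
  CHOICE inside the `μ₃`-coset, NOT implied by the CM step's conclusion — do not add it "for free").
  GLOBALLY: the Hecke character `θ` of `ν` and the central character `ω_π`
  (`AutomorphicRepData.exists_centralCharacter`, proved: `ω(ϖ_v) = det t_{π,v}`) satisfy **`θ³ = ω_π`**
  (`adRel_heckeCharacter_cube_eq_centralCharacter`, rigidity `ext_of_eventually_valueAtUniformizer_eq`)
  and the character `ε` of `η` satisfies `ε³ ω_π² = 1` (`essSelfDual_heckeCharacter_cube`).  So the
  conjunct `ν.1.IsRegularAlgebraic` is the ARCHIMEDEAN statement "the Hecke cube roots of `ω_π` are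
  algebraic" — no `σ`, no Gelbart–Jacquet at infinity, no `IsCMField`.
* §9 `L` (cycle 2) ITS ARCHIMEDEAN SHADOW (Mathlib-only): `3P = A_σ`, `3Q = A_σ̄`, `P - Q ∈ ℤ` and Clozel
  purity `A_σ + A_σ̄ = 3w` force `P, Q ∈ ℤ` (`nuShadow_integral`); purity is load-bearing (`A = 1, B = 4`:
  `nuShadow_needs_purity`) and so is the character condition (`A = 1, B = 2`: `nuShadow_needs_character`);
  essential self-duality + purity force `3 ∣ A_σ` (`essSelfDual_centre_cube`, tight without purity) — a
  ONE-LINE SANITY TEST for any candidate counterexample `π`: if `3 ∤ Σ_i a_{σ,i}` at some `σ`, the candidate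
  is not essentially self-dual or not cuspidal.  Route 1 (middle exponent) is arithmetically empty
  (`nuShadow_route1`): all its content is the archimedean matching, which route 2 avoids.
* §10 `L` (cycle 2) THE SHARPENED REDUCTION: `NuAlgebraicInput'` (the `ν` of Thm A's `∃` may be ANY
  Borel–Jacquet datum, e.g. a `log‖·‖`-twisted line — RE-CHOOSE it: only its Satake values matter,
  `adRel_congr_nu`), `NuCubeAlgebraic` (σ-FREE and FIELD-FREE: RA cuspidal `π` on `GL₃`, `det t_π = d³`
  a.e. ⇒ some RA GL(1) datum has the Satake values of `ν`; TRUE on paper over every number field by §8–§9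
  + `Clozel1990_regularAlgebraic.purity`, the one unproved input), and
  `cmStep_of_regularTwistCM_of_cube : SelfdualGL3AdjointLift → RegularTwistCM → NuCubeAlgebraic → CMStep`,
  and conversely `not_crux_imp : ¬ RegularAdjointLiftCM → ¬ RegularTwistCM ∨ ¬ NuCubeAlgebraic` (WHERE
  NOT TO HUNT: a counterexample hunter may ignore `ν`).
  MUTATION FINDING: `IsCMField` is UNNECESSARY for the `ν`-conjunct; it is load-bearing only for the
  re-twist of `σ` (sibling crux `RegularTwistCM`, whose disprover's `Negative/ArchShadow*.lean` carry that
  bookkeeping — not duplicated here).  For refuters: with Thm A granted, a counterexample to the crux is a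
  counterexample to `RegularTwistCM` or a RA cuspidal `π` on `GL₃` whose central character has a
  non-algebraic Hecke cube root — the latter excluded by purity.
* CYCLE-2 RE-AUDIT of the typed predicates (no junk escape): `AutomorphicRepData` is a genuine subquotient of
  automorphic forms (`IsStableSubmodule.le_automorphicForms`), cuspidality is `W ≤ cuspFormsGL`;
  `HasSatakeParamAt` is Tamagawa-normalised (`i = n` eigenvalue `= det`); `IsRegularAlgebraic` reads only the
  `a`-multisets (pairing free, harmless: C-algebraic entries pair with integral differences);
  `Ideal.inertiaDeg q R` is the genuine residue degree, so `quadSign L v = -1` at the infinitely many inert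
  `v` and `NonDihedral` is not degenerate; GL(1) data are lines (`finrank_quot_glOne`) with archimedean
  parameters (`exists_hasArchParameter_glOne`).  Literature (negative results / Cor B of Ramakrishnan 2014
  over CM): nothing new found (see NOTES; searchd partly unavailable this cycle).

* §11 `L` (cycle 3) **THE CRUX ⟺ ITS SIBLING.**  `CMStep → RegularTwistCM` granted multiplicity one for `SL(2)`
  (`regularTwistCM_of_cmStep`: `AdRel π σ₀ ν` makes `π` essentially self-dual WITH A DATUM — the GL(1) line of
  `θ_ν⁻²`, `exists_essSelfDualSatake_of_adRel` — the CM step returns a RA `σ`, and `unique_up_to_twist` makes it an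
  a.e. Satake twist of `σ₀` by a Hecke character, realised as a GL(1) datum `exists_cuspidal_glOne_satake`); with
  §10: `regularAdjointLiftCM_iff_regularTwistCM (hM) (hA) (hN : NuCubeAlgebraic) : RegularAdjointLiftCM ↔ RegularTwistCM`
  and `cmStep_iff_regularTwistCM`.  Negative forms (landable): `not_cmStep_of_not_regularTwistCM`,
  `regularAdjointLiftCM_false_of_not_regularTwistCM (hM) (hA) : ¬RegularTwistCM → ¬RegularAdjointLiftCM`.
  CONSEQUENCE: the planner's r2/r3 split has no slack — the two cruxes are ONE problem; every kill or proof of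
  `RegularTwistCM` (separately staffed, own Disproof with `ArchShadow*` negatives) transfers.
* §12 `L`+`P` (cycle 3) **TARGETS — the line's last stub `HermitianSymmetry`** (verbatim: every cuspidal datum on
  `GL_n`, any `n ≥ 1`, any `K`, has `χ(ῑ) = {-ā + c : a ∈ χ(ι)}` for ONE real `c`).  `P`: TRUE on paper — an
  irreducible subquotient of cusp forms is `π^u ⊗ |det|_𝔸^{-s}` with `π^u` unitary cuspidal and `s` real
  (`|ω_π| = ‖·‖^t`, a continuous hom `𝕀_K/Kˣ → ℝ_{>0}` kills the compact `𝕀¹/Kˣ`); unitarity gives `λ ∼_W -λ̄`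
  (Knapp–Vogan IX §1; the tree's `HasHCParameter.map_neg_conj_of_skewHermitian` is exactly this for a skew-Hermitian
  sesquilinear `B` with ONE `B(v,v) ≠ 0`), and the twist shifts EVERY entry at EVERY embedding by `-s`
  (`HasArchParameter.of_map_mulChar_detTwist`: at a complex place `|det|_w = |·|_ℂ = z z̄` shifts both `χ(ι)` and
  `χ(ῑ)` by `s`), so `c = -2s` is uniform over real AND complex places — no hidden place-dependence.  `L`:
  `hermitianSymmetry_shift_pinned` (`card χ(ι) · c = Σχ(ῑ) + conj Σχ(ι)`: the `∃ c` is decided at ONE embedding; for a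
  RA `GL₃` type `c = (A_ι + A_ῑ)/3 =` Clozel's weight); the natural strengthening `c = 0` (`HermitianSymmetryZero`,
  "the parameter itself is Hermitian", true for unitary `π_∞`) is **REFUTED unconditionally**
  (`not_hermitianSymmetryZero`: `n = 1`, `K = ℚ`, the GL(1) line of the trivial character and its twist by `‖det‖`,
  whose parameter is shifted by `1` — the tree's cusp forms carry no `A_G`-normalisation, cf. the tree's own
  `AutomorphicRepsGLLogDetCounterexample`); cuspidality is load-bearing on paper for `n ≥ 2` (the Eisenstein
  representation `I(‖·‖, ‖·‖^{i})` of `GL₂(𝔸_ℚ)` is an irreducible automorphic NON-cuspidal representation with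
  parameter `{1, i}`, and `{1, i} ≠ {c - 1, c + i}` for every real `c`; no tree witness — Eisenstein series are not
  constructible); at `n = 1` the statement holds for EVERY datum, junk included (the tree's `π_log = span{log‖·‖,1}/ℂ·1`
  has the trivial action on its quotient, parameter `{0}`; a Hecke-character line `θ` has `χ(ι_w) = {u}`, `χ(ῑ_w) = {v}`
  with `θ_w = z^u z̄^v`, `|θ| = ‖·‖^t` forcing `Re(u+v) = 2t`, `Im u = Im v`, i.e. `v = -ū + 2t`) — and this `n = 1` case is
  now KERNEL-CHECKED for every Borel–Jacquet datum: `hermitianSymmetry_glOne` / `hermitianSymmetry_cuspidal_glOne` (§12b;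
  `c = 2σ` with `|θ_π| = ‖·‖^σ`, via `heckeCharacter_glOne_det_ofArch_expMem`, `exists_norm_apply_eq_ideleNorm_rpow`,
  `ideleNorm_det_ofInfinite_expGL_eq`, `archParameter_clauses_glOne`).  So no cheap kill of
  the stub exists; its proof is the unitarity assembly the lead describes (clean model + `A_G`-unitarising complex
  twist + Petersson form + `map_neg_conj_of_skewHermitian`), all inputs PROVED in the tree but never assembled
  (there is no `ClozelPurityProofs` file: purity on Borel–Jacquet data is not in the tree under any name).
* CYCLE-3 RE-AUDIT (junk data): the tree PROVES `cuspidal_W'_eq_bot` FALSE (`AutomorphicRepsGLLogDetCounterexample`: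
  non-split cuspidal data exist, e.g. `(log|det|·V₀ + V₀)/V₀` over any clean `V₀`); such data are harmless for the
  crux — the quotient is `(𝔤,K)×G(𝔸_f)`-isomorphic to `V₀` (`r(h)(log|det|·φ) ≡ log|det|·r(h)φ mod V₀`), so Satake
  parameters (Hecke eigenvalues mod `W'`) and archimedean parameters agree with those of `V₀`.  The Harish-Chandra
  homomorphism EXISTS in the tree (`ArchParameterUnique` imports `HarishChandraGLExistence`; `hasArchParameter_unique`
  is proved), so the `∀ γ` clause of `HasHCParameter` pins `χ`: no junk archimedean parameter can be fed to
  `IsRegularAlgebraic` or to `HermitianSymmetry`.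

Dead ends (one line each): junk `σ` with no Satake parameters cannot witness the conclusion
(`NonDihedral` fails for it: the inner `∀ᶠ` is then trivially true); junk GL(1) `η` (log-twisted
line) has the Satake values of an honest Hecke character, so the hypothesis is not junk-satisfiable;
a `(n-1)/2`-convention slip in `IsCAlgebraic` would NOT falsify the item (over CM both parities of the
re-twist are reachable, §6); `quadSign` at ramified `v` is `+1` (f = 1), finitely many, harmless.
-/

open scoped BigOperators Topology Classical
open Filter Set Function IsDedekindDomain NumberField
open Literature.NumberTheory.Automorphic

set_option linter.dupNamespace false

-- Mathlib idiom (Mathlib/Algebra/Lie/OfAssociative.lean): commutator brackets (`𝔤 →ₗ⁅ℝ⁆ End V`, §12)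
attribute [local instance 100] LieRing.ofAssociativeRing

noncomputable section

namespace Summit.Langlands.Langlands.Cruxes.RegularAdjointLiftCM.Disproof

open Summit.Langlands.Langlands.Theses.IrreducibilityBySelfDuality

/-! ## §1 Anatomy: the crux is `SelfdualGL3AdjointLift → CMStep`, definitionally -/

section Defs

variable {K : Type} [Field K] [NumberField K]

/-- `π` (cuspidal on `GL₃/K`) is **essentially self-dual at Satake level** with GL(1) witness `η`:
a.e. `t_{π,v}⁻¹ = e_v · t_{π,v}`, `{e_v}` the Satake parameter of `η` (verbatim the route text). -/
def EssSelfDualSatake {h3 : isCompact_glFiniteIntegralLevel 3 K} {h1 : isCompact_glFiniteIntegralLevel 1 K}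
    (π : CuspidalAutomorphicRepData 3 K h3) (η : CuspidalAutomorphicRepData 1 K h1) : Prop :=
  ∀ᶠ v in cofinite, ∀ α : Multiset ℂ, π.1.HasSatakeParamAt v α →
    ∃ e : ℂ, η.1.HasSatakeParamAt v {e} ∧ α.map (fun a => a⁻¹) = α.map (fun a => e * a)

/-- The inlined quadratic sign `ε_{L/K}(v)`: `+1` iff some prime of `L` over `v` has residue degree
`1` (split or ramified `v`), `-1` otherwise (inert `v`). -/
def quadSign (L : Type) [Field L] [NumberField L] [Algebra K L] (v : HeightOneSpectrum (𝓞 K)) : ℂ :=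
  if ∃ w : HeightOneSpectrum (𝓞 L), w.asIdeal.under (𝓞 K) = v.asIdeal ∧ w.asIdeal.inertiaDeg (𝓞 K) = 1
  then (1 : ℂ) else -1

/-- `σ` (cuspidal on `GL₂/K`) is **non-dihedral at Satake level**: for no quadratic `L/K` is
`t_{σ,v} = ε_{L/K}(v) t_{σ,v}` for almost all `v` (verbatim the route text). -/
def NonDihedral {h2 : isCompact_glFiniteIntegralLevel 2 K} (σ : CuspidalAutomorphicRepData 2 K h2) :
    Prop :=
  ∀ (L : Type) [Field L] [NumberField L] [Algebra K L], Module.finrank K L = 2 →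
    ¬ (∀ᶠ v in cofinite, ∀ β : Multiset ℂ, σ.1.HasSatakeParamAt v β →
        β.map (fun b => quadSign L v * b) = β)

/-- The **adjoint relation at Satake level**: a.e. `t_{π,v} = d_v · Ad(t_{σ,v})`, `{d_v}` the Satake
parameter of the GL(1) datum `ν` (verbatim the route text, `adParams` being the tree's name for the
inlined `((β ×ˢ β).map (p ↦ p.1 p.2⁻¹)).erase 1`). -/
def AdRel {h3 : isCompact_glFiniteIntegralLevel 3 K} {h2 : isCompact_glFiniteIntegralLevel 2 K}
    {h1 : isCompact_glFiniteIntegralLevel 1 K} (π : CuspidalAutomorphicRepData 3 K h3)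
    (σ : CuspidalAutomorphicRepData 2 K h2) (ν : CuspidalAutomorphicRepData 1 K h1) : Prop :=
  ∀ᶠ v in cofinite, ∀ α β : Multiset ℂ, π.1.HasSatakeParamAt v α → σ.1.HasSatakeParamAt v β →
    ∃ d : ℂ, ν.1.HasSatakeParamAt v {d} ∧ α = (adParams β).map (fun c => d * c)

/-- `σ` is an **a.e. Satake twist** of `σ₀` by the GL(1) datum `χ`: a.e. `t_{σ,v} = c_v t_{σ₀,v}`
(verbatim the output clause of the sibling crux `RegularTwistCM`). -/
def IsSatakeTwistOf {h2 : isCompact_glFiniteIntegralLevel 2 K} {h1 : isCompact_glFiniteIntegralLevel 1 K}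
    (σ σ₀ : CuspidalAutomorphicRepData 2 K h2) (χ : CuspidalAutomorphicRepData 1 K h1) : Prop :=
  ∀ᶠ v in cofinite, ∀ β : Multiset ℂ, σ₀.1.HasSatakeParamAt v β →
    ∃ c : ℂ, χ.1.HasSatakeParamAt v {c} ∧ σ.1.HasSatakeParamAt v (β.map (fun b => c * b))

end Defs

/-- **The CM step** = the conclusion of the crux (its second half), verbatim up to the §1 names:
for `K` CM, `π` regular algebraic cuspidal on `GL₃(𝔸_K)` essentially self-dual at Satake level, there
are `σ` REGULAR ALGEBRAIC non-dihedral cuspidal on `GL₂(𝔸_K)` and `ν` algebraic with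
`t_π = ν · Ad(t_σ)` a.e. -/
def CMStep : Prop :=
  ∀ (K : Type) [Field K] [NumberField K], IsCMField K →
    ∀ (h1 : isCompact_glFiniteIntegralLevel 1 K) (hcpt₂ : isCompact_glFiniteIntegralLevel 2 K)
      (hcpt : isCompact_glFiniteIntegralLevel 3 K) (π : CuspidalAutomorphicRepData 3 K hcpt),
      π.1.IsRegularAlgebraic → (∃ η : CuspidalAutomorphicRepData 1 K h1, EssSelfDualSatake π η) →
        ∃ (σ : CuspidalAutomorphicRepData 2 K hcpt₂) (ν : CuspidalAutomorphicRepData 1 K h1),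
          σ.1.IsRegularAlgebraic ∧ ν.1.IsRegularAlgebraic ∧ NonDihedral σ ∧ AdRel π σ ν

/-- **Anatomy (definitional).** The crux IS "input item `SelfdualGL3AdjointLift` ⇒ the CM step". -/
theorem regularAdjointLiftCM_iff : RegularAdjointLiftCM ↔ (SelfdualGL3AdjointLift → CMStep) :=
  Iff.rfl

/-- The crux is only as strong as its CM half: were the INPUT item `SelfdualGL3AdjointLift`
(stmt-Langlands-13621, Ramakrishnan 2014 Thm A at Satake level) false, the crux would hold
vacuously.  In particular a refutation of the crux must PROVE Thm A in Lean — out of reach. -/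
theorem of_not_selfdualGL3AdjointLift (h : ¬ SelfdualGL3AdjointLift) : RegularAdjointLiftCM :=
  fun hA => absurd hA h

/-- The CM step alone proves the crux. -/
theorem of_cmStep (h : CMStep) : RegularAdjointLiftCM := fun _ => h

/-- Conversely the crux and the input give the CM step. -/
theorem cmStep_of (h : RegularAdjointLiftCM) (hA : SelfdualGL3AdjointLift) : CMStep := h hA

/-! ## §2 The prefix `∀ K, IsCMField K → ∀ h1 hcpt₂ hcpt` is instantiable; levels are irrelevant -/

/-- `ℚ(ζ₃)` is a CM field in Mathlib's sense (`IsCyclotomicExtension.Rat.isCMField`; the `ℚ`-algebra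
diamond on `CyclotomicField 3 ℚ` is crossed by `Subsingleton (Algebra ℚ _)`). -/
theorem isCMField_cyclotomicField_three : IsCMField (CyclotomicField 3 ℚ) := by
  have h1 : @IsCyclotomicExtension {3} ℚ (CyclotomicField 3 ℚ) _ _ (CyclotomicField.algebra 3 ℚ) :=
    CyclotomicField.instIsCyclotomicExtensionSingletonNatSetOfCharZero 3 ℚ
  have e : (CyclotomicField.algebra 3 ℚ : Algebra ℚ (CyclotomicField 3 ℚ)) =
      DivisionRing.toRatAlgebra := Subsingleton.elim _ _
  have h2 : @IsCyclotomicExtension {3} ℚ (CyclotomicField 3 ℚ) _ _ DivisionRing.toRatAlgebra := by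
    rw [← e]; exact h1
  exact @IsCyclotomicExtension.Rat.isCMField (CyclotomicField 3 ℚ) _ _ {3} ⟨3, rfl, by norm_num⟩ h2

/-- **The field/level prefix of the CM step is inhabited**: a CM field with level witnesses in all
three ranks (`isCompact_glFiniteIntegralLevel_holds`, proved in the tree).  What is NOT constructible
is the next binder, a regular algebraic essentially self-dual cuspidal `π` on `GL₃`. -/
theorem prefix_inhabited : ∃ (K : Type) (_ : Field K) (_ : NumberField K), IsCMField K ∧
    isCompact_glFiniteIntegralLevel 1 K ∧ isCompact_glFiniteIntegralLevel 2 K ∧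
      isCompact_glFiniteIntegralLevel 3 K :=
  ⟨CyclotomicField 3 ℚ, inferInstance, inferInstance, isCMField_cyclotomicField_three,
    isCompact_glFiniteIntegralLevel_holds 1 _, isCompact_glFiniteIntegralLevel_holds 2 _,
    isCompact_glFiniteIntegralLevel_holds 3 _⟩

/-- The CM step with the three level witnesses FIXED to the tree's canonical ones. -/
def CMStepCanonical : Prop :=
  ∀ (K : Type) [Field K] [NumberField K], IsCMField K →
    ∀ (π : CuspidalAutomorphicRepData 3 K (isCompact_glFiniteIntegralLevel_holds 3 K)),
      π.1.IsRegularAlgebraic →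
        (∃ η : CuspidalAutomorphicRepData 1 K (isCompact_glFiniteIntegralLevel_holds 1 K),
            EssSelfDualSatake π η) →
          ∃ (σ : CuspidalAutomorphicRepData 2 K (isCompact_glFiniteIntegralLevel_holds 2 K))
            (ν : CuspidalAutomorphicRepData 1 K (isCompact_glFiniteIntegralLevel_holds 1 K)),
            σ.1.IsRegularAlgebraic ∧ ν.1.IsRegularAlgebraic ∧ NonDihedral σ ∧ AdRel π σ ν

/-- **Level witnesses are proof-irrelevant**: the CM step is equivalent to its instance at the
canonical witnesses (definitional proof irrelevance of `Prop`).  Provers may fix `h1 hcpt₂ hcpt`. -/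
theorem cmStep_iff_canonical : CMStep ↔ CMStepCanonical :=
  ⟨fun h K _ _ hK π => h K hK _ _ _ π, fun h K _ _ hK _ _ _ π => h K hK π⟩

/-! ## §3 Satake algebra: the Satake half of the CM step is free; the residue is archimedean -/

section Satake

/-- Rankin–Selberg data are blind to a common twist: `{(ca)(cb)⁻¹} = {ab⁻¹}` (`c ≠ 0`). -/
theorem rsData_map_mul (s t : Multiset ℂ) {c : ℂ} (hc : c ≠ 0) :
    rsData (s.map (c * ·)) (t.map (c * ·)) = rsData s t := by
  induction s using Multiset.induction_on with
  | empty => simp [rsData_zero]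
  | cons a s ih =>
      rw [Multiset.map_cons, rsData_cons, rsData_cons, ih, Multiset.map_map]
      congr 1
      refine Multiset.map_congr rfl fun y _ => ?_
      simp only [Function.comp_apply]
      rw [mul_inv, mul_mul_mul_comm, mul_inv_cancel₀ hc, one_mul]

/-- **`Ad` is twist-invariant**: `Ad(c · β) = Ad(β)` for `c ≠ 0` — the unramified shadow of
`Ad(σ ⊗ χ) = Ad(σ)`.  This is why re-twisting the `GL₂` descent costs nothing at Satake level. -/
theorem adParams_map_mul (β : Multiset ℂ) {c : ℂ} (hc : c ≠ 0) :
    adParams (β.map (c * ·)) = adParams β := by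
  change (rsData _ _).erase 1 = (rsData _ _).erase 1
  rw [rsData_map_mul β β hc]

variable {K : Type} [Field K] [NumberField K] {h1 : isCompact_glFiniteIntegralLevel 1 K}
  {h2 : isCompact_glFiniteIntegralLevel 2 K} {h3 : isCompact_glFiniteIntegralLevel 3 K}

/-- A GL(1) Satake value is non-zero (entries of Satake parameters are non-zero, tree lemma
`AutomorphicRepData.HasSatakeParamAt.zero_not_mem`). -/
theorem ne_zero_of_hasSatakeParamAt_singleton {χ : CuspidalAutomorphicRepData 1 K h1}
    {v : HeightOneSpectrum (𝓞 K)} {c : ℂ} (h : χ.1.HasSatakeParamAt v {c}) : c ≠ 0 :=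
  fun h0 => h.zero_not_mem (by simp [h0])

/-- **The adjoint relation is invariant under a.e. Satake twists of `σ`** (Satake uniqueness and
a.e. unramifiedness of `σ₀`, both PROVED in the tree — Flath; and `adParams_map_mul`). -/
theorem adRel_of_isSatakeTwistOf {π : CuspidalAutomorphicRepData 3 K h3}
    {σ σ₀ : CuspidalAutomorphicRepData 2 K h2} {ν χ : CuspidalAutomorphicRepData 1 K h1}
    (h : AdRel π σ₀ ν) (htw : IsSatakeTwistOf σ σ₀ χ) : AdRel π σ ν := by
  have hcof : ∀ᶠ v in cofinite, σ₀.1.IsUnramifiedAt v := σ₀.1.hasSatakeParamAt_cofinite_holds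
  filter_upwards [h, htw, hcof] with v hv htv hur α β hα hβ
  obtain ⟨β₀, hβ₀⟩ := hur
  obtain ⟨c, hc, hσ⟩ := htv β₀ hβ₀
  have hββ : β = β₀.map (c * ·) := σ.1.hasSatakeParamAt_unique_holds hβ hσ
  obtain ⟨d, hd, hαd⟩ := hv α β₀ hα hβ₀
  exact ⟨d, hd, by rw [hαd, hββ, adParams_map_mul β₀ (ne_zero_of_hasSatakeParamAt_singleton hc)]⟩

/-- **Non-dihedrality is invariant under a.e. Satake twists** (same inputs; `Multiset.map (c * ·)` is
injective for `c ≠ 0`). -/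
theorem nonDihedral_of_isSatakeTwistOf {σ σ₀ : CuspidalAutomorphicRepData 2 K h2}
    {χ : CuspidalAutomorphicRepData 1 K h1} (h : NonDihedral σ₀) (htw : IsSatakeTwistOf σ σ₀ χ) :
    NonDihedral σ := by
  intro L _ _ _ hL hdi
  refine h L hL ?_
  filter_upwards [hdi, htw] with v hv htv β₀ hβ₀
  obtain ⟨c, hc, hσ⟩ := htv β₀ hβ₀
  have hc0 : c ≠ 0 := ne_zero_of_hasSatakeParamAt_singleton hc
  have key := hv (β₀.map (c * ·)) hσ
  rw [Multiset.map_map] at key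
  have key' : (β₀.map fun b => quadSign L v * b).map (c * ·) = β₀.map (c * ·) := by
    rw [Multiset.map_map]
    refine Eq.trans (Multiset.map_congr rfl fun b _ => ?_) key
    simp only [Function.comp_apply]
    ring
  exact Multiset.map_injective (mul_right_injective₀ hc0) key'

/-- **The conclusion re-implies the hypothesis shape** with multiplier `d_v⁻²`: if
`t_π = d · Ad(t_σ)` then `t_π⁻¹ = d⁻² · t_π` (tree lemma `map_inv_adParams_twist`).  So hypothesis
and conclusion are consistent, and `η` is pinned by `ν` only up to an a.e. self-twist multiplier of
`t_π` (`e_v d_v² · t_π = t_π`, a cube root of unity by determinants) — absorbed by `∃ d`. -/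
theorem essSelfDual_of_adRel {π : CuspidalAutomorphicRepData 3 K h3}
    {σ : CuspidalAutomorphicRepData 2 K h2} {ν : CuspidalAutomorphicRepData 1 K h1}
    (h : AdRel π σ ν) :
    ∀ᶠ v in cofinite, ∀ α : Multiset ℂ, π.1.HasSatakeParamAt v α →
      ∃ d : ℂ, ν.1.HasSatakeParamAt v {d} ∧ α.map (fun a => a⁻¹) = α.map (fun a => (d ^ 2)⁻¹ * a) := by
  have hcof : ∀ᶠ v in cofinite, σ.1.IsUnramifiedAt v := σ.1.hasSatakeParamAt_cofinite_holds
  filter_upwards [h, hcof] with v hv hur α hα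
  obtain ⟨β, hβ⟩ := hur
  obtain ⟨d, hd, hαd⟩ := hv α β hα hβ
  refine ⟨d, hd, ?_⟩
  rw [hαd]
  exact map_inv_adParams_twist β (ne_zero_of_hasSatakeParamAt_singleton hd)

end Satake

/-- **The residual archimedean input (c)** of the planner's list, as a precise `Prop`: over a CM
field, if `π` is regular algebraic and `t_π = ν · Ad(t_σ)` a.e. then the GL(1) datum `ν` is
algebraic.  Paper, two routes: (1) `π_w ≅ Ad(σ_w) ⊗ ν_w` (Gelbart–Jacquet at `w ∣ ∞` + JS strong
multiplicity one with archimedean components), so `ν_w = z^{p} z̄^{q}` is the MIDDLE parameter of `π_w`,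
integral; (2) cheaper, through the centre only (crux idea `nu-cubed-central-character`, checked on paper
by this seat): `det Ad(β) = 1` gives `d_v³ = ∏ t_{π,v} = ω_π(ϖ_v)` a.e., so `ν³ = ω_π` as Hecke
characters; at a complex place `ν_w = z^P z̄^Q` with `P - Q ∈ ℤ`, `3P = A_w`, `3Q = B_w` (sums of the HC
exponents of `π`), and purity `A_w + B_w = 3w₀` gives `3 ∣ 2A_w`, hence `P, Q ∈ ℤ`.  NOT derivable from
Satake data alone: `π ⊗ ‖·‖^{1/3} = Ad(σ) ⊗ (ν‖·‖^{1/3})` has the same finite shape with a non-algebraic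
`ν`; it is `π.IsRegularAlgebraic` read AT INFINITY (route 1: the middle exponent; route 2: `ω_π` +
purity) that pins `ν`. -/
def NuAlgebraicInput : Prop :=
  ∀ (K : Type) [Field K] [NumberField K], IsCMField K →
    ∀ (h1 : isCompact_glFiniteIntegralLevel 1 K) (h2 : isCompact_glFiniteIntegralLevel 2 K)
      (h3 : isCompact_glFiniteIntegralLevel 3 K) (π : CuspidalAutomorphicRepData 3 K h3)
      (σ : CuspidalAutomorphicRepData 2 K h2) (ν : CuspidalAutomorphicRepData 1 K h1),
      π.1.IsRegularAlgebraic → AdRel π σ ν → ν.1.IsRegularAlgebraic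

/-- **Where the difficulty sits (checked reduction).**  Modulo the input item `SelfdualGL3AdjointLift`
(Thm A) and the sibling crux `RegularTwistCM` (a regular algebraic a.e. twist of the descent exists
over CM), the CM step is EXACTLY `NuAlgebraicInput`: Satake uniqueness turns Thm A's clause into
`AdRel π σ₀ ν`, `RegularTwistCM` re-twists `σ₀ ↦ σ`, and §3 transports `AdRel` and `NonDihedral`
along the twist for free.  (For provers: this is the composition the planner foresaw; for refuters:
a counterexample to the crux with Thm A granted is a counterexample to `RegularTwistCM` or to
`NuAlgebraicInput`, nothing else.) -/
theorem cmStep_of_regularTwistCM (hA : SelfdualGL3AdjointLift) (hT : RegularTwistCM)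
    (hN : NuAlgebraicInput) : CMStep := by
  intro K _ _ hK h1 h2 h3 π hπ hη
  obtain ⟨η, hη⟩ := hη
  obtain ⟨σ₀, ν, hnd, hrel⟩ := hA K h1 h2 h3 π η hη
  have had : AdRel π σ₀ ν := by
    filter_upwards [hrel] with v hv α β hα hβ
    obtain ⟨d, e, hd, -, -, hP⟩ := hv β hβ
    exact ⟨d, hd, π.1.hasSatakeParamAt_unique_holds hα hP⟩
  obtain ⟨σ, χ, hσ, htw⟩ := hT K hK h1 h2 h3 π σ₀ ν hπ had
  exact ⟨σ, ν, hσ, hN K hK h1 h2 h3 π σ₀ ν hπ had, nonDihedral_of_isSatakeTwistOf hnd htw,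
    adRel_of_isSatakeTwistOf had htw⟩

/-! ## §4 Load-bearing hypotheses: typed variants, the implications INTO the crux, paper status -/

/-- **Variant: `IsCMField` DROPPED** (any number field).  FALSE on paper: over a real quadratic
`F` take a non-paritious Hilbert newform `σ₀` (weights of different parity at the two real places;
such forms exist over every totally real field of degree ≥ 2 — Patrikis 2019, arXiv:1207.6724,
Lemma 5.2.8; explicit ones in Dembélé–Loeffler–Pacetti, Math. Z. 2019).  Then `π = Ad(σ₀)` is cuspidal
(σ₀ non-CM), self-dual, REGULAR ALGEBRAIC on `GL₃/F` (the parity defect cancels in `χ₁/χ₂`), its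
`GL₂`-descents are the twists `σ₀ ⊗ χ` (multiplicity one for `SL(2)`, Ramakrishnan 2000 Thm 4.1.2;
tree: `Ramakrishnan2014_selfdualGL3_adjointLift.unique_up_to_twist`), and none is algebraic: an
algebraic-making `χ` would need `χ_w = |x|^{s} sgn^{a_w}` with `s ∈ ½ + ℤ` at one real place and
`s ∈ ℤ` at the other, impossible since Hecke characters of a totally real field have parallel
modulus exponent (Dirichlet: `Σ_w s_w log|u_w| = 0` on the unit lattice).  No Lean witness (Hilbert
newforms are not constructible in the tree); recorded so that nobody re-proposes the field-free form. -/
def CMStepAnyField : Prop :=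
  ∀ (K : Type) [Field K] [NumberField K]
    (h1 : isCompact_glFiniteIntegralLevel 1 K) (hcpt₂ : isCompact_glFiniteIntegralLevel 2 K)
    (hcpt : isCompact_glFiniteIntegralLevel 3 K) (π : CuspidalAutomorphicRepData 3 K hcpt),
    π.1.IsRegularAlgebraic → (∃ η : CuspidalAutomorphicRepData 1 K h1, EssSelfDualSatake π η) →
      ∃ (σ : CuspidalAutomorphicRepData 2 K hcpt₂) (ν : CuspidalAutomorphicRepData 1 K h1),
        σ.1.IsRegularAlgebraic ∧ ν.1.IsRegularAlgebraic ∧ NonDihedral σ ∧ AdRel π σ ν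

/-- **Variant: `IsCMField` WEAKENED to `IsTotallyComplex`.**  EXPECTED FALSE on paper (witness not
verified here): over a non-CM totally imaginary field `K` the re-twisting character of §6 need not
exist.  Patrikis 2019 (= arXiv:1207.6724), Lemma 2.1.5 (read, p. 19 of the arXiv text): a character
with archimedean angular residues `(m_v mod n)_v` has a unitary type-A Hecke extension iff `m_v`
depends only on `v|_{K_cm}` (`K_cm` the maximal CM subfield); "over a non-CM field we can produce
characters that have no type A extensions" (p. 20).  In the σ₀-situation the required parities are
`m_w ≡ k_{1,w} + N (mod 2)` with `N` uniform (§6), and the modulus part is pinned too, so two complex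
places of `K` over one place of `K_cm` carrying `k_{1,w}` of different parity obstruct every regular
algebraic twist; a cuspidal `σ₀` of that archimedean shape with `Ad(σ₀)` regular algebraic would refute
this variant (its existence is the unverified part).  The CM case escapes because the units of `K⁺`
are REAL at every complex place (angular parts die on the totally positive ones) and
`[𝓞_K^× : μ_K 𝓞_{K⁺}^×] ≤ 2`: the lever is that index, not "no real places". -/
def CMStepTotallyComplex : Prop :=
  ∀ (K : Type) [Field K] [NumberField K], IsTotallyComplex K →
    ∀ (h1 : isCompact_glFiniteIntegralLevel 1 K) (hcpt₂ : isCompact_glFiniteIntegralLevel 2 K)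
      (hcpt : isCompact_glFiniteIntegralLevel 3 K) (π : CuspidalAutomorphicRepData 3 K hcpt),
      π.1.IsRegularAlgebraic → (∃ η : CuspidalAutomorphicRepData 1 K h1, EssSelfDualSatake π η) →
        ∃ (σ : CuspidalAutomorphicRepData 2 K hcpt₂) (ν : CuspidalAutomorphicRepData 1 K h1),
          σ.1.IsRegularAlgebraic ∧ ν.1.IsRegularAlgebraic ∧ NonDihedral σ ∧ AdRel π σ ν

/-- **Variant: regularity of `π` DROPPED** (`π` merely C-algebraic).  FALSE on paper: let `f` be an
exotic (non-dihedral) weight-one newform over `ℚ` — e.g. the tetrahedral form of level 133 — and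
`σ₀ = BC_{K/ℚ}(π_f)` for a CM field `K` in which `f` stays cuspidal non-dihedral; `π := Ad(σ₀)` is
cuspidal (Gelbart–Jacquet), self-dual, C-algebraic with archimedean exponents `{0, 0, 0}` at every
complex place (IRREGULAR), and every twist `σ₀ ⊗ χ` has equal `z`-exponents `s + c, s + c` at each
place, never regular.  So the conclusion `σ.1.IsRegularAlgebraic` is unreachable: regularity of `π`
is load-bearing (refuter g45-10's "Maass-type lifts" mutation, made precise: the algebraic irregular
case already kills it). -/
def CMStepCAlgebraic : Prop :=
  ∀ (K : Type) [Field K] [NumberField K], IsCMField K →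
    ∀ (h1 : isCompact_glFiniteIntegralLevel 1 K) (hcpt₂ : isCompact_glFiniteIntegralLevel 2 K)
      (hcpt : isCompact_glFiniteIntegralLevel 3 K) (π : CuspidalAutomorphicRepData 3 K hcpt),
      π.1.IsCAlgebraic → (∃ η : CuspidalAutomorphicRepData 1 K h1, EssSelfDualSatake π η) →
        ∃ (σ : CuspidalAutomorphicRepData 2 K hcpt₂) (ν : CuspidalAutomorphicRepData 1 K h1),
          σ.1.IsRegularAlgebraic ∧ ν.1.IsRegularAlgebraic ∧ NonDihedral σ ∧ AdRel π σ ν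

/-- The field-free variant implies the totally-complex one (trivially). -/
theorem cmStepTotallyComplex_of_anyField (h : CMStepAnyField) : CMStepTotallyComplex :=
  fun K _ _ _ h1 h2 h3 π hπ hη => h K h1 h2 h3 π hπ hη

/-- The totally-complex variant implies the CM step (a CM field is totally complex, Mathlib instance
`NumberField.IsCMField.isTotallyComplex`). -/
theorem cmStep_of_totallyComplex (h : CMStepTotallyComplex) : CMStep := by
  intro K _ _ hK h1 h2 h3 π hπ hη
  haveI := hK
  exact h K inferInstance h1 h2 h3 π hπ hη

/-- The field-free variant implies the CM step. -/
theorem cmStep_of_anyField (h : CMStepAnyField) : CMStep :=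
  cmStep_of_totallyComplex (cmStepTotallyComplex_of_anyField h)

/-- The irregular variant implies the CM step (regular algebraic ⇒ C-algebraic, tree lemma). -/
theorem cmStep_of_cAlgebraic (h : CMStepCAlgebraic) : CMStep :=
  fun K _ _ hK h1 h2 h3 π hπ hη => h K hK h1 h2 h3 π hπ.isCAlgebraic hη

/-! ## §4b The kill criterion, formalised; the load-bearing lemmas modulo their (unconstructible) witnesses

Granted multiplicity one for `SL(2)` (the tree's named fact `Ramakrishnan2000_multiplicityOneSL2`,
Ramakrishnan 2000 Thm 4.1.2, through the PROVED `Ramakrishnan2014_selfdualGL3_adjointLift.unique_up_to_twist`),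
the `GL₂`-descent of `π` is unique up to an a.e. Satake twist by a Hecke character.  Hence ANY
statement of the shape "… ⇒ ∃ σ ν, σ regular algebraic ∧ … ∧ t_π = ν Ad(t_σ) a.e." is killed by ONE
`π` admitting a descent `σ₀` NO Satake twist of which is regular algebraic (`no_regular_descent`).
Specialised: `cmStepAnyField_false_of` (witness over any field — a non-paritious Hilbert newform,
EXPECTED TO EXIST), `cmStepCAlgebraic_false_of` (irregular witness over a CM field — `Ad` of a
weight-one base change, EXPECTED TO EXIST), and `kill_criterion` (a REGULAR witness over a CM field —
EXPECTED NOT TO EXIST by §6; this is the crux's kill criterion in Lean: given Thm A and multiplicity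
one, refuting the crux is EQUIVALENT to producing such a `π`).  None of these is filed
`--negative-modulo`: the first two concern variants, and the third's hypothesis is believed empty. -/

section KillCriterion

variable {F : Type} [Field F] [NumberField F] {hF1 : isCompact_glFiniteIntegralLevel 1 F}
  {hF2 : isCompact_glFiniteIntegralLevel 2 F} {hF3 : isCompact_glFiniteIntegralLevel 3 F}

open Literature.NumberTheory.GaloisRepresentations (HeckeCharacter)

/-- **GL(1) dictionary, pointwise**: the Satake values of a GL(1) datum `ν` are the values at
uniformizers of its Hecke character (tree: `exists_heckeCharacter_glOne`,
`isUnramifiedAt_heckeCharacter_glOne`, `exists_eq_singleton_of_hasSatakeParamAt_glOne`,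
`localComponent_eq_valueAtUniformizer` — all proved). -/
theorem exists_heckeCharacter_satake_eq (ν : CuspidalAutomorphicRepData 1 F hF1) :
    ∃ θ : HeckeCharacter F, ∀ (v : HeightOneSpectrum (𝓞 F)) (d : ℂ),
      ν.1.HasSatakeParamAt v {d} → d = θ.valueAtUniformizer v := by
  obtain ⟨θ, hθ⟩ := ν.1.exists_heckeCharacter_glOne
  refine ⟨θ, fun v d hd => ?_⟩
  have hur : θ.IsUnramifiedAt v := ν.1.isUnramifiedAt_heckeCharacter_glOne hθ hd
  obtain ⟨ϖ, hϖ, hdϖ⟩ := ν.1.exists_eq_singleton_of_hasSatakeParamAt_glOne hθ hd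
  rw [Multiset.singleton_inj.mp hdϖ, ← HeckeCharacter.localComponent_apply,
    HeckeCharacter.localComponent_eq_valueAtUniformizer hur hϖ]

/-- **No regular descent from one bad descent.**  If `t_π = ν₀ · Ad(t_{σ₀})` a.e. for a cuspidal
`σ₀` none of whose a.e. Satake twists by Hecke characters is regular algebraic, then (multiplicity
one for `SL(2)`) NO pair `(σ, ν)` with `σ` regular algebraic satisfies `AdRel π σ ν`. -/
theorem no_regular_descent (hM : Ramakrishnan2000_multiplicityOneSL2)
    (π : CuspidalAutomorphicRepData 3 F hF3) (σ₀ : CuspidalAutomorphicRepData 2 F hF2)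
    (ν₀ : HeckeCharacter F)
    (had : ∀ᶠ v in cofinite, ∀ β : Multiset ℂ, σ₀.1.HasSatakeParamAt v β →
      π.1.HasSatakeParamAt v ((adParams β).map fun c => ν₀.valueAtUniformizer v * c))
    (hnp : ∀ (σ : CuspidalAutomorphicRepData 2 F hF2) (χ : HeckeCharacter F),
      IsSatakeTwistBy σ₀.1 σ.1 χ → ¬ σ.1.IsRegularAlgebraic) :
    ¬ ∃ (σ : CuspidalAutomorphicRepData 2 F hF2) (ν : CuspidalAutomorphicRepData 1 F hF1),
        σ.1.IsRegularAlgebraic ∧ AdRel π σ ν := by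
  rintro ⟨σ, ν, hσ, hrel⟩
  obtain ⟨θ, hθ⟩ := exists_heckeCharacter_satake_eq ν
  have hrel' : ∀ᶠ v in cofinite, ∀ β : Multiset ℂ, σ.1.HasSatakeParamAt v β →
      π.1.HasSatakeParamAt v ((adParams β).map fun c => θ.valueAtUniformizer v * c) := by
    filter_upwards [hrel, π.1.hasSatakeParamAt_cofinite_holds] with v hv hπu β hβ
    obtain ⟨α, hα⟩ := hπu
    obtain ⟨d, hd, hαd⟩ := hv α β hα hβ
    rw [← hθ v d hd, ← hαd]
    exact hα
  obtain ⟨χ, hχ⟩ := Ramakrishnan2014_selfdualGL3_adjointLift.unique_up_to_twist hM had hrel'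
  exact hnp σ χ hχ hσ

/-- **`IsCMField` is load-bearing, modulo a non-paritious witness.**  A regular algebraic,
essentially self-dual cuspidal `π` on `GL₃` over SOME number field with a descent `σ₀` no Satake
twist of which is regular algebraic (paper: `π = Ad(σ₀)`, `σ₀` a non-paritious Hilbert newform over
a real quadratic field) refutes the field-free variant. -/
theorem cmStepAnyField_false_of (hM : Ramakrishnan2000_multiplicityOneSL2)
    (π : CuspidalAutomorphicRepData 3 F hF3) (η : CuspidalAutomorphicRepData 1 F hF1)
    (σ₀ : CuspidalAutomorphicRepData 2 F hF2) (ν₀ : HeckeCharacter F)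
    (hπ : π.1.IsRegularAlgebraic) (hη : EssSelfDualSatake π η)
    (had : ∀ᶠ v in cofinite, ∀ β : Multiset ℂ, σ₀.1.HasSatakeParamAt v β →
      π.1.HasSatakeParamAt v ((adParams β).map fun c => ν₀.valueAtUniformizer v * c))
    (hnp : ∀ (σ : CuspidalAutomorphicRepData 2 F hF2) (χ : HeckeCharacter F),
      IsSatakeTwistBy σ₀.1 σ.1 χ → ¬ σ.1.IsRegularAlgebraic) :
    ¬ CMStepAnyField := fun h => by
  obtain ⟨σ, ν, hσ, -, -, hrel⟩ := h F hF1 hF2 hF3 π hπ ⟨η, hη⟩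
  exact no_regular_descent hM π σ₀ ν₀ had hnp ⟨σ, ν, hσ, hrel⟩

/-- **`IsRegularAlgebraic` is load-bearing, modulo an irregular witness over a CM field**
(paper: `π = Ad(BC_{K/ℚ} f)`, `f` an exotic weight-one newform). -/
theorem cmStepCAlgebraic_false_of (hM : Ramakrishnan2000_multiplicityOneSL2) (hF : IsCMField F)
    (π : CuspidalAutomorphicRepData 3 F hF3) (η : CuspidalAutomorphicRepData 1 F hF1)
    (σ₀ : CuspidalAutomorphicRepData 2 F hF2) (ν₀ : HeckeCharacter F)
    (hπ : π.1.IsCAlgebraic) (hη : EssSelfDualSatake π η)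
    (had : ∀ᶠ v in cofinite, ∀ β : Multiset ℂ, σ₀.1.HasSatakeParamAt v β →
      π.1.HasSatakeParamAt v ((adParams β).map fun c => ν₀.valueAtUniformizer v * c))
    (hnp : ∀ (σ : CuspidalAutomorphicRepData 2 F hF2) (χ : HeckeCharacter F),
      IsSatakeTwistBy σ₀.1 σ.1 χ → ¬ σ.1.IsRegularAlgebraic) :
    ¬ CMStepCAlgebraic := fun h => by
  obtain ⟨σ, ν, hσ, -, -, hrel⟩ := h F hF hF1 hF2 hF3 π hπ ⟨η, hη⟩
  exact no_regular_descent hM π σ₀ ν₀ had hnp ⟨σ, ν, hσ, hrel⟩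

/-- **The kill criterion in Lean.**  Given Thm A (the input item) and multiplicity one for `SL(2)`,
the crux is REFUTED by — and, up to these two inputs, only by — a regular algebraic essentially
self-dual cuspidal `π` on `GL₃` over a CM field with a descent `σ₀` admitting no regular algebraic
Satake twist.  §6 explains why such a `π` should not exist (Weil's unit criterion over CM); this
theorem is documentation of the target, NOT a held negative lemma. -/
theorem kill_criterion (hM : Ramakrishnan2000_multiplicityOneSL2) (hA : SelfdualGL3AdjointLift)
    (hF : IsCMField F)
    (π : CuspidalAutomorphicRepData 3 F hF3) (η : CuspidalAutomorphicRepData 1 F hF1)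
    (σ₀ : CuspidalAutomorphicRepData 2 F hF2) (ν₀ : HeckeCharacter F)
    (hπ : π.1.IsRegularAlgebraic) (hη : EssSelfDualSatake π η)
    (had : ∀ᶠ v in cofinite, ∀ β : Multiset ℂ, σ₀.1.HasSatakeParamAt v β →
      π.1.HasSatakeParamAt v ((adParams β).map fun c => ν₀.valueAtUniformizer v * c))
    (hnp : ∀ (σ : CuspidalAutomorphicRepData 2 F hF2) (χ : HeckeCharacter F),
      IsSatakeTwistBy σ₀.1 σ.1 χ → ¬ σ.1.IsRegularAlgebraic) :
    ¬ RegularAdjointLiftCM := fun h => by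
  obtain ⟨σ, ν, hσ, -, -, hrel⟩ := h hA F hF hF1 hF2 hF3 π hπ ⟨η, hη⟩
  exact no_regular_descent hM π σ₀ ν₀ had hnp ⟨σ, ν, hσ, hrel⟩

/-- Conversely, of course, the witness `σ₀` of `kill_criterion` cannot come from the crux's own
output: if the crux holds (with Thm A), every `π` in its scope HAS a regular algebraic descent, so no
descent `σ₀` of such a `π` can have the `hnp` property (multiplicity one again).  Stated as the
contrapositive bookkeeping a triager needs: the crux + Thm A + multiplicity one ⇒ every descent of
every regular algebraic essentially self-dual cuspidal `π` over a CM field has a regular algebraic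
a.e. Satake twist by a Hecke character. -/
theorem descent_has_regular_twist (hM : Ramakrishnan2000_multiplicityOneSL2)
    (hA : SelfdualGL3AdjointLift) (h : RegularAdjointLiftCM) (hF : IsCMField F)
    (π : CuspidalAutomorphicRepData 3 F hF3) (η : CuspidalAutomorphicRepData 1 F hF1)
    (σ₀ : CuspidalAutomorphicRepData 2 F hF2) (ν₀ : HeckeCharacter F)
    (hπ : π.1.IsRegularAlgebraic) (hη : EssSelfDualSatake π η)
    (had : ∀ᶠ v in cofinite, ∀ β : Multiset ℂ, σ₀.1.HasSatakeParamAt v β →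
      π.1.HasSatakeParamAt v ((adParams β).map fun c => ν₀.valueAtUniformizer v * c)) :
    ∃ (σ : CuspidalAutomorphicRepData 2 F hF2) (χ : HeckeCharacter F),
      IsSatakeTwistBy σ₀.1 σ.1 χ ∧ σ.1.IsRegularAlgebraic := by
  by_contra hne
  exact kill_criterion hM hA hF π η σ₀ ν₀ hπ hη had (fun σ χ hχ hσ => hne ⟨σ, χ, hχ, hσ⟩) h

end KillCriterion

/-! ## §5–§6 Paper status: false strengthenings; why the crux resists (the CM unit computation) -/

/-- **Why the CM step is true on paper (and what exactly `IsCMField` buys).**  Let `K` be CM with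
maximal real subfield `K⁺`, `π` regular algebraic cuspidal on `GL₃(𝔸_K)`, essentially self-dual.
By Thm A, `π ≅ Ad(σ₀) ⊗ ν₀` with `σ₀` cuspidal non-dihedral; by Gelbart–Jacquet at `w ∣ ∞` and JS
strong multiplicity one, `π_w ≅ Ad(σ₀,w) ⊗ ν₀,w` at every (complex) place `w`.  Write
`σ₀,w = PS(χ₁, χ₂)`, `χ_j = |z|_ℂ^{u_j}(z/|z|)^{k_j}` i.e. `z^{s_j} z̄^{t_j}`, `s_j = u_j + k_j/2`,
`t_j = u_j - k_j/2`.  `Ad`'s parameter is `{χ₁/χ₂, 1, χ₂/χ₁}`; `π_w` regular algebraic forces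
`ν₀,w = z^p z̄^q` with `p, q ∈ ℤ` (the middle exponent) and `χ₁/χ₂ = z^{a} z̄^{b}`, `a, b ∈ ℤ ∖ {0}`;
unitarity of `σ₀` up to `|det|^x` (or Clozel purity `a + b = 0`) then gives `u₁ = u₂ =: u_w`
(complementary series are excluded: `|z|_ℂ^{4x}`, `0 < x < ½`, is not integral), `b = -a`,
`k₁ ≡ k₂ (2)`, `k₁ ≠ k₂`.  A twist `σ₀ ⊗ χ`, `χ_w = z^{c_w} z̄^{d_w}`, is regular algebraic iff
`c_w ∈ ½ - s_{1,w} + ℤ` and `d_w ∈ ½ - t_{1,w} + ℤ`; locally this is always solvable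
(`s₁ - t₁ = k₁ ∈ ℤ`).  GLOBALLY (Weil 1956 / Chevalley 1951): `χ_∞ = ∏_w χ_w` is the infinity type of a
Hecke character iff it kills a finite-index subgroup of `𝓞_K^×`.  Take `c_w + d_w = 1 - 2u_w + N`
(`N ∈ ℤ` the same at every `w`) and test on `u ∈ U := ` the congruence units of `K⁺` that are totally
positive and on which `ω_{σ₀,∞}` is trivial (finite index in `𝓞_{K⁺}^×`, hence in `𝓞_K^×` BECAUSE
`K` IS CM: `[𝓞_K^× : μ_K 𝓞_{K⁺}^×] ∈ {1,2}`, Mathlib `IsCMField.indexRealUnits_eq_one_or_two`): at a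
complex `w` such `u` is REAL POSITIVE, so the angular parts `(u_w/|u_w|)^{m_w}` are `1` whatever the
parities `m_w` — THIS is the parity freedom — and the modulus part is
`∏_w u_w^{1 + N} · ∏_w u_w^{-2u_w} = N(u)^{1+N} · exp(-2 Σ_w u_w log u_w)`; `N(u) = 1`; the real parts
`Re u_w` are parallel (ω_{σ₀} is a Hecke character ⇒ `Σ 4 Re(u_w) log u_w = 0` on a lattice spanning
the trace-zero hyperplane ⇒ `Re u_w` constant), so they contribute `exp(-2R log N(u)) = 1`; the
imaginary parts satisfy `Σ_w 4 Im(u_w) log u_w ∈ 2πℤ` on `U` (again because `ω_{σ₀,∞}(u) = 1`), hence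
`Σ_w 2 Im(u_w) log u_w ∈ 2πℤ` on `U²` — the INDEX-2 PASSAGE TO SQUARES; `U²` still has finite index.
So `χ` exists, `σ := σ₀ ⊗ χ` is regular algebraic with exponents `(½+N, ½), (½+N-a, ½+a)` at `w`
(well formed, regular since `a ≠ 0`, pure of weight `1+N`), `Ad(σ) = Ad(σ₀)` (§3), non-dihedral, and
`ν = ν₀` is algebraic.  Over a TOTALLY REAL field the angular parts are signs `sgn(u_w)^{m_w}` on units
of mixed signs and the modulus exponents must be parallel, so mixed parity cannot be repaired
(`CMStepAnyField` false); over a NON-CM totally complex field the angular parts of a fundamental unit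
are generic (`CMStepTotallyComplex` false).  NOTHING here is refutable as typed: the two potentially
fragile conventions — the `(n-1)/2` shift in `IsCAlgebraic` (it is `((n:ℂ)-1)/2`, correct) and the
`(χ σ_w, χ σ̄_w)` bookkeeping of `HasArchParameter` at complex places — would, if slipped, change WHICH
parities are demanded, and over CM every parity pattern is reachable.  FALSE STRENGTHENINGS (§5 of the
module docstring): `ν = 1`; `σ` unique; `ω_σ` of finite order (fails for even `a`); `σ₀` itself RA. -/
theorem cmStep_paper_status : RegularAdjointLiftCM ↔ (SelfdualGL3AdjointLift → CMStep) :=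
  regularAdjointLiftCM_iff

section CycleTwo

open Literature.NumberTheory.GaloisRepresentations (HeckeCharacter)

/-! ## §8 The centre of the conclusion: `ν³ = ω_π` and `η³ ω_π² = 1` -/

section Centre

variable {K : Type} [Field K] [NumberField K] {h1 : isCompact_glFiniteIntegralLevel 1 K}
  {h2 : isCompact_glFiniteIntegralLevel 2 K} {h3 : isCompact_glFiniteIntegralLevel 3 K}

/-- GL(1) Satake values are pinned: two singleton Satake parameters at `v` agree. -/
theorem eq_of_hasSatakeParamAt_singleton {χ : CuspidalAutomorphicRepData 1 K h1}
    {v : HeightOneSpectrum (𝓞 K)} {c c' : ℂ} (h : χ.1.HasSatakeParamAt v {c})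
    (h' : χ.1.HasSatakeParamAt v {c'}) : c = c' :=
  Multiset.singleton_inj.mp (χ.1.hasSatakeParamAt_unique_holds h h')

/-- A GL(1) datum has a.e. a (singleton) Satake parameter. -/
theorem eventually_exists_hasSatakeParamAt_singleton (χ : CuspidalAutomorphicRepData 1 K h1) :
    ∀ᶠ v in cofinite, ∃ c : ℂ, χ.1.HasSatakeParamAt v {c} := by
  filter_upwards [χ.1.hasSatakeParamAt_cofinite_holds] with v hv
  obtain ⟨α, hα⟩ := hv
  obtain ⟨c, rfl⟩ := Multiset.card_eq_one.mp hα.card_eq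
  exact ⟨c, hα⟩

/-- `det (d · Ad(β)) = d³` for a genuine `GL₂` Satake parameter `β` (two non-zero entries). -/
theorem prod_map_mul_adParams {β : Multiset ℂ} (hβ2 : Multiset.card β = 2) (hβ0 : (0 : ℂ) ∉ β)
    (d : ℂ) : ((adParams β).map (fun c => d * c)).prod = d ^ 3 := by
  obtain ⟨x, y, rfl⟩ := Multiset.card_eq_two.mp hβ2
  have hx : x ≠ 0 := fun h => hβ0 (by simp [h])
  have hy : y ≠ 0 := fun h => hβ0 (by simp [h])
  exact prod_adParams_twist_pair d hx hy

/-- **`ν³ = ω_π` at Satake level.**  If `t_π = ν · Ad(t_σ)` a.e. (the relation `AdRel` of the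
conclusion) then a.e. `det t_{π,v} = d_v³` (`det t_{π,v} = ω_π(ϖ_v)` is the `i = n` Hecke
eigenvalue): the GL(1) datum `ν` of the conclusion is PINNED by `π` up to a.e. cube roots of unity,
so its algebraicity is decided by `π` alone (crux idea `nu-cubed-central-character`, Satake half). -/
theorem adRel_cube {π : CuspidalAutomorphicRepData 3 K h3} {σ : CuspidalAutomorphicRepData 2 K h2}
    {ν : CuspidalAutomorphicRepData 1 K h1} (h : AdRel π σ ν) :
    ∀ᶠ v in cofinite, ∀ (α : Multiset ℂ) (d : ℂ), π.1.HasSatakeParamAt v α →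
      ν.1.HasSatakeParamAt v {d} → α.prod = d ^ 3 := by
  have hcof : ∀ᶠ v in cofinite, σ.1.IsUnramifiedAt v := σ.1.hasSatakeParamAt_cofinite_holds
  filter_upwards [h, hcof] with v hv hur α d hα hd
  obtain ⟨β, hβ⟩ := hur
  obtain ⟨d', hd', hαd⟩ := hv α β hα hβ
  rw [hαd, eq_of_hasSatakeParamAt_singleton hd' hd]
  exact prod_map_mul_adParams hβ.card_eq hβ.zero_not_mem d

/-- **`η³ ω_π² = 1` at Satake level.**  Essential self-duality `t_π⁻¹ = e · t_π` a.e. forces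
`e_v³ (det t_{π,v})² = 1` (take determinants: `card t_π = 3`, entries non-zero). -/
theorem essSelfDual_cube {π : CuspidalAutomorphicRepData 3 K h3}
    {η : CuspidalAutomorphicRepData 1 K h1} (h : EssSelfDualSatake π η) :
    ∀ᶠ v in cofinite, ∀ (α : Multiset ℂ) (e : ℂ), π.1.HasSatakeParamAt v α →
      η.1.HasSatakeParamAt v {e} → e ^ 3 * α.prod ^ 2 = 1 := by
  filter_upwards [h] with v hv α e hα he
  obtain ⟨e', he', hmap⟩ := hv α hα
  obtain rfl : e' = e := eq_of_hasSatakeParamAt_singleton he' he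
  have hcard : Multiset.card α = 3 := hα.card_eq
  have hprod0 : α.prod ≠ 0 := Multiset.prod_ne_zero hα.zero_not_mem
  have key := congrArg Multiset.prod hmap
  rw [Multiset.prod_map_inv, Multiset.prod_map_mul, Multiset.map_const', Multiset.prod_replicate,
    Multiset.map_id', hcard] at key
  -- key : α.prod⁻¹ = e' ^ 3 * α.prod
  have : e' ^ 3 * α.prod ^ 2 = α.prod⁻¹ * α.prod := by rw [key]; ring
  rw [this, inv_mul_cancel₀ hprod0]

/-- **`ν` is unique up to a.e. cube roots of unity**: two pairs `(σ, ν)`, `(σ', ν')` in the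
relation `AdRel` with the same `π` have `d_v³ = d'_v³` a.e. -/
theorem adRel_cube_unique {π : CuspidalAutomorphicRepData 3 K h3}
    {σ σ' : CuspidalAutomorphicRepData 2 K h2} {ν ν' : CuspidalAutomorphicRepData 1 K h1}
    (h : AdRel π σ ν) (h' : AdRel π σ' ν') :
    ∀ᶠ v in cofinite, ∀ d d' : ℂ, ν.1.HasSatakeParamAt v {d} → ν'.1.HasSatakeParamAt v {d'} →
      d ^ 3 = d' ^ 3 := by
  have hcof : ∀ᶠ v in cofinite, π.1.IsUnramifiedAt v := π.1.hasSatakeParamAt_cofinite_holds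
  filter_upwards [adRel_cube h, adRel_cube h', hcof] with v hv hv' hur d d' hd hd'
  obtain ⟨α, hα⟩ := hur
  rw [← hv α d hα hd, ← hv' α d' hα hd']

/-- **Hypothesis vs conclusion at the centre**: under `AdRel π σ ν` and `EssSelfDualSatake π η`,
`(e_v d_v²)³ = 1` a.e. — `d² e` is an a.e. CUBE ROOT OF UNITY, not necessarily `1`.  Thm A's
output normalisation `d² e = 1` (input item `SelfdualGL3AdjointLift`) is a CHOICE of `ν` inside its
`μ₃`-coset, not a consequence of the CM step's conclusion (for `π` with a cubic self-twist `μ`,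
`ν ↦ ν μ` keeps `AdRel` and breaks `d² e = 1`): do not add `d² e = 1` to the conclusion "for free". -/
theorem adRel_essSelfDual_cube {π : CuspidalAutomorphicRepData 3 K h3}
    {σ : CuspidalAutomorphicRepData 2 K h2} {ν η : CuspidalAutomorphicRepData 1 K h1}
    (h : AdRel π σ ν) (hη : EssSelfDualSatake π η) :
    ∀ᶠ v in cofinite, ∀ d e : ℂ, ν.1.HasSatakeParamAt v {d} → η.1.HasSatakeParamAt v {e} →
      (e * d ^ 2) ^ 3 = 1 := by
  have hcof : ∀ᶠ v in cofinite, π.1.IsUnramifiedAt v := π.1.hasSatakeParamAt_cofinite_holds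
  filter_upwards [adRel_cube h, essSelfDual_cube hη, hcof] with v hv hv' hur d e hd he
  obtain ⟨α, hα⟩ := hur
  have hA := hv α d hα hd
  have hB := hv' α e hα he
  rw [hA] at hB
  linear_combination hB

/-- Powers of Hecke characters at uniformizers. -/
theorem valueAtUniformizer_pow (θ : HeckeCharacter K) (n : ℕ) (v : HeightOneSpectrum (𝓞 K)) :
    (θ ^ n).valueAtUniformizer v = θ.valueAtUniformizer v ^ n := by
  simp [HeckeCharacter.valueAtUniformizer, HeckeCharacter.localComponent_apply]

/-- **`ν³ = ω_π` GLOBALLY, kernel-checked from proved tree theorems.**  If `t_π = ν · Ad(t_σ)` a.e.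
then the Hecke character `θ` of the GL(1) datum `ν` (GL(1) dictionary, `exists_heckeCharacter_satake_eq`)
and the central character `ω` of `π` (`AutomorphicRepData.exists_centralCharacter`: `ω(ϖ_v) = det t_{π,v}`
at every unramified `v`) satisfy `θ³ = ω` (rigidity `ext_of_eventually_valueAtUniformizer_eq`).
CONSEQUENCE FOR THE CRUX: the conjunct `ν.1.IsRegularAlgebraic` of the conclusion is the purely
ARCHIMEDEAN statement "the cube roots of the central character of a regular algebraic (essentially
self-dual) cuspidal `π` on `GL₃` are algebraic" — no `σ`, no Gelbart–Jacquet at infinity, no `IsCMField`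
(see `NuCubeAlgebraic`, §10, and the exponent bookkeeping `nuShadow_integral`, §9). -/
theorem adRel_heckeCharacter_cube_eq_centralCharacter {π : CuspidalAutomorphicRepData 3 K h3}
    {σ : CuspidalAutomorphicRepData 2 K h2} {ν : CuspidalAutomorphicRepData 1 K h1}
    (h : AdRel π σ ν) :
    ∃ θ ω : HeckeCharacter K,
      (∀ (v : HeightOneSpectrum (𝓞 K)) (d : ℂ), ν.1.HasSatakeParamAt v {d} →
        d = θ.valueAtUniformizer v) ∧
      (∀ (v : HeightOneSpectrum (𝓞 K)) (α : Multiset ℂ), π.1.HasSatakeParamAt v α →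
        ω.valueAtUniformizer v = α.prod) ∧
      θ ^ 3 = ω := by
  obtain ⟨θ, hθ⟩ := exists_heckeCharacter_satake_eq ν
  obtain ⟨ω, -, hω⟩ := π.1.exists_centralCharacter
  refine ⟨θ, ω, hθ, fun v α hα => (hω hα).2, ?_⟩
  apply HeckeCharacter.ext_of_eventually_valueAtUniformizer_eq
  filter_upwards [adRel_cube h, π.1.hasSatakeParamAt_cofinite_holds,
    eventually_exists_hasSatakeParamAt_singleton ν] with v hv hπ hν
  obtain ⟨α, hα⟩ := hπ
  obtain ⟨d, hd⟩ := hν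
  rw [valueAtUniformizer_pow, ← hθ v d hd, ← hv α d hα hd, (hω hα).2]

/-- Likewise **`η³ ω_π² = 1` GLOBALLY**: the Hecke character `ε` of the self-duality datum `η` and the
central character `ω` of `π` satisfy `ε³ ω² = 1`.  (So `η` — hence `d² e` — is pinned by `π` up to
cubic characters; and `η` is algebraic iff `ω²` has algebraic cube roots.) -/
theorem essSelfDual_heckeCharacter_cube {π : CuspidalAutomorphicRepData 3 K h3}
    {η : CuspidalAutomorphicRepData 1 K h1} (h : EssSelfDualSatake π η) :
    ∃ ε ω : HeckeCharacter K,
      (∀ (v : HeightOneSpectrum (𝓞 K)) (e : ℂ), η.1.HasSatakeParamAt v {e} →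
        e = ε.valueAtUniformizer v) ∧
      (∀ (v : HeightOneSpectrum (𝓞 K)) (α : Multiset ℂ), π.1.HasSatakeParamAt v α →
        ω.valueAtUniformizer v = α.prod) ∧
      ε ^ 3 * ω ^ 2 = 1 := by
  obtain ⟨ε, hε⟩ := exists_heckeCharacter_satake_eq η
  obtain ⟨ω, -, hω⟩ := π.1.exists_centralCharacter
  refine ⟨ε, ω, hε, fun v α hα => (hω hα).2, ?_⟩
  apply HeckeCharacter.ext_of_eventually_valueAtUniformizer_eq
  filter_upwards [essSelfDual_cube h, π.1.hasSatakeParamAt_cofinite_holds,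
    eventually_exists_hasSatakeParamAt_singleton η] with v hv hπ hη
  obtain ⟨α, hα⟩ := hπ
  obtain ⟨e, he⟩ := hη
  have hmul : (ε ^ 3 * ω ^ 2).valueAtUniformizer v =
      ε.valueAtUniformizer v ^ 3 * ω.valueAtUniformizer v ^ 2 := by
    simp [HeckeCharacter.valueAtUniformizer, HeckeCharacter.localComponent_apply]
  have hone : (1 : HeckeCharacter K).valueAtUniformizer v = 1 := by
    simp [HeckeCharacter.valueAtUniformizer, HeckeCharacter.localComponent_apply]
  rw [hmul, hone, ← hε v e he, (hω hα).2]
  exact hv α e hα he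

end Centre

/-! ## §9 The archimedean shadow of "`ν` is algebraic" (Mathlib-only exponent bookkeeping) -/

section NuShadow

/-- **Route 2 of `NuAlgebraicInput`, the arithmetic (purity closes it).**  At a complex place with
embeddings `σ, σ̄`: `ν_w = z^P z̄^Q` is a character of `ℂˣ` (`P - Q ∈ ℤ`); `ν³ = ω_π` (§8) gives
`3P = A`, `3Q = B` with `A = A_σ`, `B = A_σ̄` the sums of the Harish-Chandra exponents of `π` at `σ, σ̄`
(integers: `π` is regular algebraic on `GL₃`, exponents in `(3-1)/2 + ℤ = ℤ`); Clozel purity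
`p_i + q_i = w` summed gives `A + B = 3w`.  THEN `P, Q ∈ ℤ`.  At a real place the same with `A = B`
(`2A = 3w`).  No `IsCMField` anywhere. -/
theorem nuShadow_integral (A B m w : ℤ) (P Q : ℂ) (hP : 3 * P = A) (hQ : 3 * Q = B)
    (hPQ : P - Q = m) (hpure : (A : ℂ) + B = 3 * w) : ∃ k l : ℤ, P = k ∧ Q = l := by
  refine ⟨2 * (m + w) - A, 2 * (m + w) - A - m, ?_, ?_⟩
  · push_cast
    linear_combination (-1 / 3 : ℂ) * hP + (2 / 3 : ℂ) * hQ + 2 * hPQ + (2 / 3 : ℂ) * hpure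
  · push_cast
    linear_combination (-1 / 3 : ℂ) * hP + (2 / 3 : ℂ) * hQ + hPQ + (2 / 3 : ℂ) * hpure

/-- **Purity is load-bearing for route 2**: without `A + B = 3w` the cube root of an integral type
need not be integral — `A = 1`, `B = 4`, `ν_w = z^{1/3} z̄^{4/3}` is a character of `ℂˣ`
(`P - Q = -1`) with `3P = A`, `3Q = B`, and `P ∉ ℤ`. -/
theorem nuShadow_needs_purity : ∃ (A B m : ℤ) (P Q : ℂ), 3 * P = A ∧ 3 * Q = B ∧ P - Q = m ∧
    ∀ k : ℤ, P ≠ k := by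
  refine ⟨1, 4, -1, 1 / 3, 4 / 3, by push_cast; ring, by push_cast; ring, by push_cast; ring,
    fun k hk => ?_⟩
  have h3 : (1 : ℂ) = 3 * k := by linear_combination 3 * hk
  have h3' : (1 : ℤ) = 3 * k := by exact_mod_cast h3
  omega

/-- **The character condition `P - Q ∈ ℤ` is load-bearing too**: `A = 1`, `B = 2` is pure
(`w = 1`) and `3P = A`, `3Q = B` has the solution `P = 1/3`, `Q = 2/3`, `P ∉ ℤ` — excluded only because
`z^{1/3} z̄^{2/3}` is not a character of `ℂˣ`.  (For the Hecke character `θ` of `ν` this condition is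
automatic; it is recorded to show that `3 ∣ A_σ` is NOT a consequence of purity alone.) -/
theorem nuShadow_needs_character : ∃ (A B w : ℤ) (P Q : ℂ), 3 * P = A ∧ 3 * Q = B ∧
    (A : ℂ) + B = 3 * w ∧ ∀ k : ℤ, P ≠ k := by
  refine ⟨1, 2, 1, 1 / 3, 2 / 3, by push_cast; ring, by push_cast; ring, by push_cast; ring,
    fun k hk => ?_⟩
  have h3 : (1 : ℂ) = 3 * k := by linear_combination 3 * hk
  have h3' : (1 : ℤ) = 3 * k := by exact_mod_cast h3
  omega

/-- **The centre of an essentially self-dual regular algebraic `π` on `GL₃` is a cube at infinity.**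
From `η³ ω_π² = 1` (§8): `η_w = z^p z̄^q` with `p - q ∈ ℤ`, `3p = -2A`, `3q = -2B`; with purity
`A + B = 3w` this forces `3 ∣ A` (and `3 ∣ B`).  So for the `π` of the crux the central character HAS
algebraic cube roots place by place — consistent with §8/`nuShadow_integral`, and a cheap sanity test a
counterexample hunter can run on any candidate `π`: if `3 ∤ A_σ`, the candidate is not essentially
self-dual (or not pure, i.e. not cuspidal). -/
theorem essSelfDual_centre_cube (A B w m : ℤ) (p q : ℂ) (hp : 3 * p = -2 * A) (hq : 3 * q = -2 * B)
    (hpq : p - q = m) (hpure : (A : ℂ) + B = 3 * w) : ∃ k : ℤ, A = 3 * k := by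
  have h : (4 : ℂ) * A = 6 * w - 3 * m := by linear_combination hp - hq - 3 * hpq + 2 * hpure
  have hz : 4 * A = 6 * w - 3 * m := by exact_mod_cast h
  exact ⟨2 * w - m - A, by omega⟩

/-- Tightness of `essSelfDual_centre_cube`: without purity, `A = 1`, `B = -2`, `η_w = z^{-2/3} z̄^{4/3}`
(`p - q = -2`) satisfies the centre identity with `3 ∤ A`. -/
theorem essSelfDual_centre_cube_needs_purity : ∃ (A B m : ℤ) (p q : ℂ), 3 * p = -2 * A ∧
    3 * q = -2 * B ∧ p - q = m ∧ ∀ k : ℤ, A ≠ 3 * k :=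
  ⟨1, -2, -2, -2 / 3, 4 / 3, by push_cast; ring, by push_cast; ring, by push_cast; ring,
    fun k hk => by omega⟩

/-- **Route 1 (the middle exponent) is arithmetically empty**: if the three exponents
`{P + a, P, P - a}` of `π_w = Ad(σ_w) ⊗ ν_w` are integers then so is `P` — trivially; ALL the content
of route 1 is the archimedean matching `π_w ≅ Ad(σ_{0,w}) ⊗ ν_{0,w}` (Gelbart–Jacquet at `w ∣ ∞` + JS
strong multiplicity one with archimedean components), which route 2 (`ν³ = ω_π`, §8) avoids. -/
theorem nuShadow_route1 (P a : ℂ) (k₁ k₂ k₃ : ℤ) (h₁ : P + a = k₁) (h₂ : P = k₂) (h₃ : P - a = k₃) :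
    ∃ k : ℤ, P = k ∧ ∃ l : ℤ, a = l :=
  ⟨k₂, h₂, k₁ - k₂, by push_cast; linear_combination h₁ - h₂ + 0 * h₃⟩

end NuShadow

/-! ## §10 Reductions: what exactly remains of the crux after Thm A and `RegularTwistCM` -/

/-- **`NuAlgebraicInput` with `ν` RE-CHOSEN** (weaker than `NuAlgebraicInput`, and all the CM step
needs): the GL(1) datum `ν` handed over by Thm A's `∃` may be ANY Borel–Jacquet datum with the right
Satake values (e.g. a `log‖·‖`-twisted line, on which `IsRegularAlgebraic` is awkward to certify); the
conclusion of the crux only needs SOME regular algebraic `ν'` with the same Satake values a.e. — the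
honest datum `ℂ · (θ ∘ det)` of the Hecke character `θ` of `ν`
(`exists_cuspidal_glOne_hasSatakeParamAt_valueAtUniformizer`, proved). -/
def NuAlgebraicInput' : Prop :=
  ∀ (K : Type) [Field K] [NumberField K], IsCMField K →
    ∀ (h1 : isCompact_glFiniteIntegralLevel 1 K) (h2 : isCompact_glFiniteIntegralLevel 2 K)
      (h3 : isCompact_glFiniteIntegralLevel 3 K) (π : CuspidalAutomorphicRepData 3 K h3)
      (σ : CuspidalAutomorphicRepData 2 K h2) (ν : CuspidalAutomorphicRepData 1 K h1),
      π.1.IsRegularAlgebraic → AdRel π σ ν →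
        ∃ ν' : CuspidalAutomorphicRepData 1 K h1, ν'.1.IsRegularAlgebraic ∧
          ∀ᶠ v in cofinite, ∀ d : ℂ, ν.1.HasSatakeParamAt v {d} → ν'.1.HasSatakeParamAt v {d}

/-- **THE σ-FREE, FIELD-FREE RESIDUE** (recommended target for the `ν`-conjunct): over ANY number
field, if `π` is regular algebraic cuspidal on `GL₃` and the GL(1) datum `ν` satisfies
`det t_{π,v} = d_v³` a.e., then some regular algebraic GL(1) datum has the Satake values of `ν` a.e.
Paper proof (true for every `K`, CM or not): `θ³ = ω_π` (§8, kernel-checked); `ω_π` has integral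
infinity type `(A_σ)_σ` (the centre acts at infinity through the trace of the Harish-Chandra parameter —
tree: `AutomorphicRepData.centralCharacter_det_ofInfinite_expGL` + `HasHCParameter.hasCentralCharacter_aeval`);
Clozel purity `A_σ + A_σ̄ = 3w` (`Clozel1990_regularAlgebraic.purity`, the one unproved input); the
infinity type `(P_w, Q_w)` of `θ` has `P - Q ∈ ℤ` and `3(P, Q) = (A_σ, A_σ̄)`; `nuShadow_integral` (§9);
the honest datum of `θ` is regular algebraic (`GLOneArchParameterOfAlgebraicCharacter`).  MUTATION
FINDING: `IsCMField` is UNNECESSARY for the `ν`-conjunct of the crux — it is load-bearing only for the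
re-twist of `σ` (sibling crux `RegularTwistCM`). -/
def NuCubeAlgebraic : Prop :=
  ∀ (K : Type) [Field K] [NumberField K] (h1 : isCompact_glFiniteIntegralLevel 1 K)
    (h3 : isCompact_glFiniteIntegralLevel 3 K) (π : CuspidalAutomorphicRepData 3 K h3)
    (ν : CuspidalAutomorphicRepData 1 K h1), π.1.IsRegularAlgebraic →
      (∀ᶠ v in cofinite, ∀ (α : Multiset ℂ) (d : ℂ), π.1.HasSatakeParamAt v α →
        ν.1.HasSatakeParamAt v {d} → α.prod = d ^ 3) →
        ∃ ν' : CuspidalAutomorphicRepData 1 K h1, ν'.1.IsRegularAlgebraic ∧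
          ∀ᶠ v in cofinite, ∀ d : ℂ, ν.1.HasSatakeParamAt v {d} → ν'.1.HasSatakeParamAt v {d}

/-- `NuAlgebraicInput → NuAlgebraicInput'` (take `ν' = ν`). -/
theorem nuAlgebraicInput'_of (h : NuAlgebraicInput) : NuAlgebraicInput' :=
  fun K _ _ hK h1 h2 h3 π σ ν hπ had =>
    ⟨ν, h K hK h1 h2 h3 π σ ν hπ had, Eventually.of_forall fun _ _ hd => hd⟩

/-- `NuCubeAlgebraic → NuAlgebraicInput'` (by `adRel_cube`, §8): the `ν`-conjunct of the crux needs
nothing about `σ` and nothing about the field. -/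
theorem nuAlgebraicInput'_of_cube (h : NuCubeAlgebraic) : NuAlgebraicInput' :=
  fun K _ _ _ h1 _ h3 π _ ν hπ had => h K h1 h3 π ν hπ (adRel_cube had)

section Rechoose

variable {K : Type} [Field K] [NumberField K] {h1 : isCompact_glFiniteIntegralLevel 1 K}
  {h2 : isCompact_glFiniteIntegralLevel 2 K} {h3 : isCompact_glFiniteIntegralLevel 3 K}

/-- `AdRel` only sees the Satake values of `ν`: it is transported along a.e. agreement. -/
theorem adRel_congr_nu {π : CuspidalAutomorphicRepData 3 K h3} {σ : CuspidalAutomorphicRepData 2 K h2}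
    {ν ν' : CuspidalAutomorphicRepData 1 K h1} (h : AdRel π σ ν)
    (hνν' : ∀ᶠ v in cofinite, ∀ d : ℂ, ν.1.HasSatakeParamAt v {d} → ν'.1.HasSatakeParamAt v {d}) :
    AdRel π σ ν' := by
  filter_upwards [h, hνν'] with v hv hv' α β hα hβ
  obtain ⟨d, hd, hαd⟩ := hv α β hα hβ
  exact ⟨d, hv' d hd, hαd⟩

end Rechoose

/-- **The checked reduction, sharpened** (supersedes `cmStep_of_regularTwistCM` of §3): Thm A +
`RegularTwistCM` + the σ-free, field-free `NuCubeAlgebraic` prove the CM step.  For refuters: given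
Thm A, a counterexample to the crux is a counterexample to `RegularTwistCM` or to `NuCubeAlgebraic`;
the latter would be a regular algebraic cuspidal `π` on `GL₃` (over any field) whose central character
has a NON-algebraic Hecke cube root — excluded by purity (§9). -/
theorem cmStep_of_regularTwistCM_of_cube (hA : SelfdualGL3AdjointLift) (hT : RegularTwistCM)
    (hN : NuCubeAlgebraic) : CMStep := by
  intro K _ _ hK h1 h2 h3 π hπ hη
  obtain ⟨η, hη⟩ := hη
  obtain ⟨σ₀, ν, hnd, hrel⟩ := hA K h1 h2 h3 π η hη
  have had : AdRel π σ₀ ν := by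
    filter_upwards [hrel] with v hv α β hα hβ
    obtain ⟨d, e, hd, -, -, hP⟩ := hv β hβ
    exact ⟨d, hd, π.1.hasSatakeParamAt_unique_holds hα hP⟩
  obtain ⟨σ, χ, hσ, htw⟩ := hT K hK h1 h2 h3 π σ₀ ν hπ had
  obtain ⟨ν', hν', hνν'⟩ := nuAlgebraicInput'_of_cube hN K hK h1 h2 h3 π σ₀ ν hπ had
  exact ⟨σ, ν', hσ, hν', nonDihedral_of_isSatakeTwistOf hnd htw,
    adRel_congr_nu (adRel_of_isSatakeTwistOf had htw) hνν'⟩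

/-- The same with the intermediate `NuAlgebraicInput'`. -/
theorem cmStep_of_regularTwistCM' (hA : SelfdualGL3AdjointLift) (hT : RegularTwistCM)
    (hN : NuAlgebraicInput') : CMStep := by
  intro K _ _ hK h1 h2 h3 π hπ hη
  obtain ⟨η, hη⟩ := hη
  obtain ⟨σ₀, ν, hnd, hrel⟩ := hA K h1 h2 h3 π η hη
  have had : AdRel π σ₀ ν := by
    filter_upwards [hrel] with v hv α β hα hβ
    obtain ⟨d, e, hd, -, -, hP⟩ := hv β hβ
    exact ⟨d, hd, π.1.hasSatakeParamAt_unique_holds hα hP⟩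
  obtain ⟨σ, χ, hσ, htw⟩ := hT K hK h1 h2 h3 π σ₀ ν hπ had
  obtain ⟨ν', hν', hνν'⟩ := hN K hK h1 h2 h3 π σ₀ ν hπ had
  exact ⟨σ, ν', hσ, hν', nonDihedral_of_isSatakeTwistOf hnd htw,
    adRel_congr_nu (adRel_of_isSatakeTwistOf had htw) hνν'⟩

/-- **Where NOT to hunt** (contrapositive of `cmStep_of_regularTwistCM_of_cube`): granted Thm A, a
failure of the CM step is a failure of `RegularTwistCM` (the re-twist of `σ`, sibling crux) or of
`NuCubeAlgebraic` (the cube roots of `ω_π`, excluded by purity §9) — nothing else.  So a counterexample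
hunter should look for a CM field `K` and a regular algebraic essentially self-dual cuspidal `π` on
`GL₃(𝔸_K)` whose descent `σ₀` has NO regular algebraic twist (kill criterion §4b), and may IGNORE `ν`. -/
theorem not_cmStep_imp (hA : SelfdualGL3AdjointLift) (h : ¬ CMStep) :
    ¬ RegularTwistCM ∨ ¬ NuCubeAlgebraic := by
  by_cases hT : RegularTwistCM
  · exact Or.inr fun hN => h (cmStep_of_regularTwistCM_of_cube hA hT hN)
  · exact Or.inl hT

/-- The same for the crux itself: `¬ RegularAdjointLiftCM → SelfdualGL3AdjointLift ∧ ¬ CMStep`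
(definitional), hence `→ ¬ RegularTwistCM ∨ ¬ NuCubeAlgebraic`. -/
theorem not_crux_imp (h : ¬ RegularAdjointLiftCM) : ¬ RegularTwistCM ∨ ¬ NuCubeAlgebraic := by
  have hA : SelfdualGL3AdjointLift := by
    by_contra hA
    exact h (of_not_selfdualGL3AdjointLift hA)
  exact not_cmStep_imp hA (fun hC => h (of_cmStep hC))

/-- **Remark on the irregular mutation (`CMStepCAlgebraic`, §4), sharpened by §8–§9**: for `π`
merely C-algebraic (irregular allowed) the `ν`-conjunct STILL holds on paper — Clozel purity is stated
for algebraic, not necessarily regular, cuspidal `π`, so `θ³ = ω_π` and `nuShadow_integral` apply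
verbatim; the irregular mutation fails ONLY at `σ.1.IsRegularAlgebraic` (no twist of a parallel
weight-one `σ₀` is regular).  Recorded as the trivial implication it induces. -/
theorem nuCubeAlgebraic_irregular_remark (h : NuCubeAlgebraic) : NuAlgebraicInput' :=
  nuAlgebraicInput'_of_cube h

end CycleTwo

section CycleThree

open Literature.NumberTheory.GaloisRepresentations (HeckeCharacter localUnits)

/-! ## §11 (cycle 3) The crux and its sibling `RegularTwistCM` are EQUIVALENT modulo the inputs -/

section Sibling

variable {K : Type} [Field K] [NumberField K] {h1 : isCompact_glFiniteIntegralLevel 1 K}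
  {h2 : isCompact_glFiniteIntegralLevel 2 K} {h3 : isCompact_glFiniteIntegralLevel 3 K}

/-- Inverses of Hecke characters at uniformizers. -/
theorem valueAtUniformizer_inv' (θ : HeckeCharacter K) (v : HeightOneSpectrum (𝓞 K)) :
    θ⁻¹.valueAtUniformizer v = (θ.valueAtUniformizer v)⁻¹ := by
  simp [HeckeCharacter.valueAtUniformizer, HeckeCharacter.localComponent_apply]

/-- **A Hecke character as a cuspidal `GL(1)` datum** with Satake parameter `{θ(ϖ_v)}` a.e. (the line
`ℂ · (θ ∘ det)` over `⊥`; re-proof of the tree's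
`exists_cuspidal_glOne_hasSatakeParamAt_valueAtUniformizer`, kept import-light). -/
theorem exists_cuspidal_glOne_satake (h1 : isCompact_glFiniteIntegralLevel 1 K) (θ : HeckeCharacter K) :
    ∃ τ : CuspidalAutomorphicRepData 1 K h1,
      ∀ᶠ v : HeightOneSpectrum (𝓞 K) in cofinite, τ.1.HasSatakeParamAt v {θ.valueAtUniformizer v} := by
  obtain ⟨τ, hW, hW'⟩ := exists_automorphicRepData_detTwist_glOne h1 θ
  have hcusp : τ.W ≤ cuspFormsGL 1 K h1 := by
    rw [hW, Submodule.span_le]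
    rintro _ rfl
    exact IsCuspFormGL.mem_cuspFormsGL
      ⟨isAutomorphicForm_detTwist_glOne h1 θ, fun k hk hk1 => absurd hk1 (by omega)⟩
  refine ⟨⟨τ, hcusp⟩, ?_⟩
  obtain ⟨𝔪, h𝔪, hθ𝔪⟩ := HeckeCharacter.exists_level_glOne θ
  filter_upwards [(Ideal.finite_factors h𝔪).compl_mem_cofinite] with v hv
  have h := AutomorphicRepData.hasSatakeParamAt_detTwist_glOne h1 hW hW' h𝔪 hθ𝔪 v hv
    (HeckeCharacter.valued_uniformizer (K := K) v)
  have e : θ.valueAtUniformizer v =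
      ((θ (localUnits v (HeckeCharacter.uniformizer K v)) : ℂˣ) : ℂ) := by
    simp only [HeckeCharacter.valueAtUniformizer, HeckeCharacter.localComponent_apply]
  rw [e]
  exact h

/-- **`AdRel` ⇒ essential self-duality WITH a GL(1) datum**: `η :=` the datum of `θ⁻²`, `θ` the
Hecke character of `ν` (§3 `essSelfDual_of_adRel` gave the Satake shape `t_π⁻¹ = d⁻² t_π`; the GL(1)
dictionary supplies the datum).  So the INPUT shape of the crux is implied by its OUTPUT shape with
an honest witness — used in `regularTwistCM_of_cmStep`. -/
theorem exists_essSelfDualSatake_of_adRel {π : CuspidalAutomorphicRepData 3 K h3}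
    {σ : CuspidalAutomorphicRepData 2 K h2} {ν : CuspidalAutomorphicRepData 1 K h1}
    (h : AdRel π σ ν) : ∃ η : CuspidalAutomorphicRepData 1 K h1, EssSelfDualSatake π η := by
  obtain ⟨θ, hθ⟩ := exists_heckeCharacter_satake_eq ν
  obtain ⟨η, hη⟩ := exists_cuspidal_glOne_satake h1 (θ ^ 2)⁻¹
  refine ⟨η, ?_⟩
  filter_upwards [essSelfDual_of_adRel h, hη] with v hv hηv α hα
  obtain ⟨d, hd, hαd⟩ := hv α hα
  refine ⟨_, hηv, ?_⟩
  rw [hαd, hθ v d hd, valueAtUniformizer_inv', valueAtUniformizer_pow]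

/-- From `AdRel` to the `HeckeCharacter` form consumed by `unique_up_to_twist`. -/
theorem adRel_heckeForm {π : CuspidalAutomorphicRepData 3 K h3}
    {σ : CuspidalAutomorphicRepData 2 K h2} {ν : CuspidalAutomorphicRepData 1 K h1}
    (h : AdRel π σ ν) :
    ∃ θ : HeckeCharacter K, ∀ᶠ v in cofinite, ∀ β : Multiset ℂ, σ.1.HasSatakeParamAt v β →
      π.1.HasSatakeParamAt v ((adParams β).map fun c => θ.valueAtUniformizer v * c) := by
  obtain ⟨θ, hθ⟩ := exists_heckeCharacter_satake_eq ν
  refine ⟨θ, ?_⟩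
  filter_upwards [h, π.1.hasSatakeParamAt_cofinite_holds] with v hv hπu β hβ
  obtain ⟨α, hα⟩ := hπu
  obtain ⟨d, hd, hαd⟩ := hv α β hα hβ
  rw [← hθ v d hd, ← hαd]
  exact hα

/-- **The CM step implies the sibling crux `RegularTwistCM`** (granted multiplicity one for
`SL(2)`, the tree's named fact `Ramakrishnan2000_multiplicityOneSL2`).  Given `π` RA with
`AdRel π σ₀ ν`: `π` is essentially self-dual with the datum of `θ_ν⁻²`
(`exists_essSelfDualSatake_of_adRel`); the CM step hands over a REGULAR ALGEBRAIC `σ` with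
`AdRel π σ ν'`; multiplicity one (`unique_up_to_twist`, proved modulo the named fact) makes `σ` an
a.e. Satake twist of `σ₀` by a Hecke character `χ`, whose GL(1) datum witnesses the conclusion. -/
theorem regularTwistCM_of_cmStep (hM : Ramakrishnan2000_multiplicityOneSL2) (h : CMStep) :
    RegularTwistCM := by
  intro K _ _ hK h1 h2 h3 π σ₀ ν hπ had
  have had' : AdRel π σ₀ ν := had
  obtain ⟨η, hη⟩ := exists_essSelfDualSatake_of_adRel had'
  obtain ⟨σ, ν', hσ, -, -, hrel⟩ := h K hK h1 h2 h3 π hπ ⟨η, hη⟩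
  obtain ⟨θ₀, had₀⟩ := adRel_heckeForm had'
  obtain ⟨θ', hrel'⟩ := adRel_heckeForm hrel
  obtain ⟨χ, hχ⟩ := Ramakrishnan2014_selfdualGL3_adjointLift.unique_up_to_twist hM had₀ hrel'
  obtain ⟨χ', hχ'⟩ := exists_cuspidal_glOne_satake h1 χ
  refine ⟨σ, χ', hσ, ?_⟩
  filter_upwards [hχ, hχ'] with v hv hv' β hβ
  exact ⟨_, hv', hv β hβ⟩

/-- Negative form: **a refutation of `RegularTwistCM` refutes the CM step** (mult. one). -/
theorem not_cmStep_of_not_regularTwistCM (hM : Ramakrishnan2000_multiplicityOneSL2)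
    (hT : ¬ RegularTwistCM) : ¬ CMStep :=
  fun h => hT (regularTwistCM_of_cmStep hM h)

/-- Negative form for the crux itself: **¬`RegularTwistCM` ⇒ ¬`RegularAdjointLiftCM`**, granted
multiplicity one for `SL(2)` and the input item (Thm A).  (Landable as a Negative/ lemma: the
conclusion is negative.) -/
theorem regularAdjointLiftCM_false_of_not_regularTwistCM (hM : Ramakrishnan2000_multiplicityOneSL2)
    (hA : SelfdualGL3AdjointLift) (hT : ¬ RegularTwistCM) : ¬ RegularAdjointLiftCM :=
  fun h => hT (regularTwistCM_of_cmStep hM (h hA))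

/-- **THE EQUIVALENCE.**  Modulo the input item (Thm A), multiplicity one for `SL(2)` and the σ-free
`ν`-residue `NuCubeAlgebraic` (§10; = the picked line `nu-cubed-central-character`, two of whose
three stubs are landed, the third being `HermitianSymmetry` of §12), **the crux `RegularAdjointLiftCM`
and its sibling `RegularTwistCM` are EQUIVALENT**: the planner's split introduced no slack, the two
rank-2/rank-3 cruxes are ONE problem, and a counterexample to either is a counterexample to both. -/
theorem regularAdjointLiftCM_iff_regularTwistCM (hM : Ramakrishnan2000_multiplicityOneSL2)
    (hA : SelfdualGL3AdjointLift) (hN : NuCubeAlgebraic) : RegularAdjointLiftCM ↔ RegularTwistCM :=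
  ⟨fun h => regularTwistCM_of_cmStep hM (h hA), fun hT _ => cmStep_of_regularTwistCM_of_cube hA hT hN⟩

/-- The same for the CM step. -/
theorem cmStep_iff_regularTwistCM (hM : Ramakrishnan2000_multiplicityOneSL2)
    (hA : SelfdualGL3AdjointLift) (hN : NuCubeAlgebraic) : CMStep ↔ RegularTwistCM :=
  ⟨regularTwistCM_of_cmStep hM, fun hT => cmStep_of_regularTwistCM_of_cube hA hT hN⟩

end Sibling

/-! ## §12 (cycle 3) TARGETS — the picked line's last open stub `HermitianSymmetry` -/

section Hermitian

/-- VERBATIM the reshaped stub 3 of `Lines/nu-cubed-central-character.lean` (line lead, 2026-08-16):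
the archimedean parameter of every cuspidal datum on `GL_n` is Hermitian-symmetric up to ONE real
shift `c`. -/
def HermitianSymmetry : Prop :=
  ∀ (n : ℕ) [NeZero n] (K : Type) [Field K] [NumberField K] (hcpt : isCompact_glFiniteIntegralLevel n K)
    (π : CuspidalAutomorphicRepData n K hcpt) (χ : (K →+* ℂ) → Multiset ℂ), π.1.HasArchParameter χ →
      ∃ c : ℝ, ∀ ι : K →+* ℂ,
        χ (ComplexEmbedding.conjugate ι) = (χ ι).map fun a => -(starRingEnd ℂ a) + (c : ℂ)

/-- The natural strengthening **`c = 0`** ("the parameter itself is Hermitian-symmetric", true for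
UNITARY `π_∞`). -/
def HermitianSymmetryZero : Prop :=
  ∀ (n : ℕ) [NeZero n] (K : Type) [Field K] [NumberField K] (hcpt : isCompact_glFiniteIntegralLevel n K)
    (π : CuspidalAutomorphicRepData n K hcpt) (χ : (K →+* ℂ) → Multiset ℂ), π.1.HasArchParameter χ →
      ∀ ι : K →+* ℂ, χ (ComplexEmbedding.conjugate ι) = (χ ι).map fun a => -(starRingEnd ℂ a)

/-- **Variant: cuspidality DROPPED** (`HermitianSymmetry` for ALL Borel–Jacquet data `W/W' ≤ 𝒜`, not only
`W ≤ 𝒜₀`).  FALSE on paper for `n = 2`, `K = ℚ`: the global principal series `I(‖·‖_𝔸, ‖·‖_𝔸^{i})` is realised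
in `𝒜(GL₂)` by Eisenstein series (holomorphic at this point, `1 - i ≠ ±1`), is irreducible (locally irreducible
everywhere: the ratio `‖·‖^{1-i}` is neither `‖·‖^{±1}` at finite places nor `x^k sgn` at `∞`), hence an
`AutomorphicRepData` with archimedean parameter `{1, i}` at the real embedding; but `{1, i} = {c - 1, c + i}` has no
real solution `c` (`1 = c - 1 ∧ i = c + i` forces `c = 2 = 0`; `1 = c + i` is not real).  No tree witness
(Eisenstein series are not constructible; the tree's only non-cuspidal data, `span{1}/⊥` and the `log|det|`
datum, have the trivial quotient with parameter `ρ = {(n-1)/2, …, -(n-1)/2}`, which IS symmetric).  Recorded so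
that nobody reshapes the stub to "every automorphic datum". -/
def HermitianSymmetryAllData : Prop :=
  ∀ (n : ℕ) [NeZero n] (K : Type) [Field K] [NumberField K] (hcpt : isCompact_glFiniteIntegralLevel n K)
    (π : AutomorphicRepData (AutomorphyDatum.gl n K hcpt)) (χ : (K →+* ℂ) → Multiset ℂ), π.HasArchParameter χ →
      ∃ c : ℝ, ∀ ι : K →+* ℂ,
        χ (ComplexEmbedding.conjugate ι) = (χ ι).map fun a => -(starRingEnd ℂ a) + (c : ℂ)

/-- The all-data variant trivially implies the stub (the implication INTO the stub, as in §4). -/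
theorem hermitianSymmetry_of_allData (h : HermitianSymmetryAllData) : HermitianSymmetry :=
  fun n _ K _ _ hcpt π χ hχ => h n K hcpt π.1 χ hχ

/-- `HermitianSymmetryZero → HermitianSymmetry` (take `c = 0`). -/
theorem hermitianSymmetry_of_zero (h : HermitianSymmetryZero) : HermitianSymmetry := by
  intro n _ K _ _ hcpt π χ hχ
  refine ⟨0, fun ι => ?_⟩
  rw [h n K hcpt π χ hχ ι]
  exact Multiset.map_congr rfl fun a _ => by simp

/-- Sum of a multiset after `a ↦ -ā + c`. -/
theorem sum_map_neg_conj_add (s : Multiset ℂ) (c : ℂ) :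
    (s.map fun a => -(starRingEnd ℂ a) + c).sum = -(starRingEnd ℂ s.sum) + Multiset.card s * c := by
  induction s using Multiset.induction_on with
  | empty => simp
  | cons a s ih =>
      rw [Multiset.map_cons, Multiset.sum_cons, Multiset.sum_cons, ih, Multiset.card_cons, map_add]
      push_cast
      ring

/-- Sum of a multiset after `a ↦ a + c`. -/
theorem sum_map_add_const (s : Multiset ℂ) (c : ℂ) :
    (s.map fun a => a + c).sum = s.sum + Multiset.card s * c := by
  induction s using Multiset.induction_on with
  | empty => simp
  | cons a s ih =>
      rw [Multiset.map_cons, Multiset.sum_cons, Multiset.sum_cons, ih, Multiset.card_cons]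
      push_cast
      ring

/-- Sum of a multiset after `a ↦ -ā`. -/
theorem sum_map_neg_conj (s : Multiset ℂ) :
    (s.map fun a => -(starRingEnd ℂ a)).sum = -(starRingEnd ℂ s.sum) := by
  have h := sum_map_neg_conj_add s 0
  simp only [add_zero, mul_zero] at h
  exact h

/-- Sum of a multiset after `a ↦ -conj(a + c)`. -/
theorem sum_map_neg_conj_add_const (s : Multiset ℂ) (c : ℂ) :
    (s.map fun a => -(starRingEnd ℂ (a + c))).sum =
      -(starRingEnd ℂ s.sum) - Multiset.card s * starRingEnd ℂ c := by
  induction s using Multiset.induction_on with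
  | empty => simp
  | cons a s ih =>
      rw [Multiset.map_cons, Multiset.sum_cons, Multiset.sum_cons, ih, Multiset.card_cons, map_add,
        map_add]
      push_cast
      ring

/-- **The shift `c` is PINNED by `χ` at any single embedding**: `card(χ ι) · c = Σ χ(ῑ) + conj Σ χ(ι)`.
For the prover: with `card = n ≥ 1` this is the explicit `c` to feed the `∃` (for a regular algebraic
`GL₃` type, `c = (A_ι + A_ῑ)/3 = w`, Clozel's weight); for the refuter: a candidate `χ` violating the
symmetry is certified by ONE embedding. -/
theorem hermitianSymmetry_shift_pinned {K : Type} [Field K] (χ : (K →+* ℂ) → Multiset ℂ) (c : ℝ)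
    (ι : K →+* ℂ)
    (h : χ (ComplexEmbedding.conjugate ι) = (χ ι).map fun a => -(starRingEnd ℂ a) + (c : ℂ)) :
    (Multiset.card (χ ι) : ℂ) * c = (χ (ComplexEmbedding.conjugate ι)).sum + starRingEnd ℂ (χ ι).sum := by
  rw [h, sum_map_neg_conj_add]
  ring

variable {K : Type} [Field K] [NumberField K] {n : ℕ} {hcpt : isCompact_glFiniteIntegralLevel n K}

/-- An archimedean parameter on `GL_n` has `n` entries at every embedding (re-proof of the tree's
`AutomorphicRepData.card_eq_of_hasArchParameter`, import-light). -/
theorem card_eq_of_hasArchParameter' {π : AutomorphicRepData (AutomorphyDatum.gl n K hcpt)}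
    {χ : (K →+* ℂ) → Multiset ℂ} (h : π.HasArchParameter χ) (σ : K →+* ℂ) :
    Multiset.card (χ σ) = n := by
  obtain ⟨ρ, -, hre, hco⟩ := h
  rcases (InfinitePlace.mk σ).isReal_or_isComplex with hw | hw
  · have h1 := (hre ⟨InfinitePlace.mk σ, hw⟩).1 (Algebra.ofId ℝ ℂ)
    dsimp only at h1
    rwa [InfinitePlace.embedding_mk_eq_of_isReal (InfinitePlace.isReal_mk_iff.mp hw)] at h1
  · rcases InfinitePlace.mk_eq_iff.mp (InfinitePlace.mk_embedding (InfinitePlace.mk σ)) with hσ | hσ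
    · have h1 := (hco ⟨InfinitePlace.mk σ, hw⟩).1 (AlgHom.id ℝ ℂ)
      dsimp only at h1
      rwa [algHomId_toRingHom_comp, hσ] at h1
    · have h1 := (hco ⟨InfinitePlace.mk σ, hw⟩).1 (Complex.conjAe : ℂ →ₐ[ℝ] ℂ)
      dsimp only at h1
      rwa [conjAe_toRingHom_comp, hσ] at h1

/-- **The real shift `c` is LOAD-BEARING: `HermitianSymmetryZero` is FALSE — unconditionally, at
`n = 1` over `ℚ`.**  Witness: ANY cuspidal `GL(1)` datum `τ` (here the line of the trivial Hecke
character) has an archimedean parameter `χ₀` (`exists_hasArchParameter_glOne`), and so does its norm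
twist `τ ⊗ ‖det‖` — namely `χ₀ + 1` (`HasArchParameter.of_map_mulChar_detTwist`); symmetry with `c = 0`
for both gives `χ₀(ῑ) = -conj χ₀(ι)` and `χ₀(ῑ) + 1 = -conj χ₀(ι) - 1`, i.e. `2 · card χ₀(ι) = 0`, while
`card χ₀(ι) = 1`.  MORAL for the prover: the tree's cusp forms carry NO `A_G`-normalisation (cf. the
tree's `AutomorphicRepsGLLogDetCounterexample`), so the unitarising twist `s` and `c = -2s` are genuine
data of the proof; for the refuter: nothing weaker than "∃ one real `c` for all `ι`" is being claimed. -/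
theorem not_hermitianSymmetryZero : ¬ HermitianSymmetryZero := by
  intro h
  haveI : NeZero (1 : ℕ) := ⟨one_ne_zero⟩
  have hcpt₁ : isCompact_glFiniteIntegralLevel 1 ℚ := isCompact_glFiniteIntegralLevel_holds 1 ℚ
  obtain ⟨τ, -⟩ := exists_cuspidal_glOne_satake hcpt₁ (1 : HeckeCharacter ℚ)
  obtain ⟨χ₀, hχ₀⟩ := τ.1.exists_hasArchParameter_glOne
  obtain ⟨μ, hμ⟩ := exists_heckeCharacter_ideleNorm_cpow (K := ℚ) ((1 : ℝ) : ℂ)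
  obtain ⟨τ', hW, hW'⟩ := exists_cuspidalAutomorphicRepData_map_mulChar_detTwist hμ τ
  have hχ₁ : τ'.1.HasArchParameter fun σ => (χ₀ σ).map (· + ((1 : ℝ) : ℂ)) :=
    AutomorphicRepData.HasArchParameter.of_map_mulChar_detTwist hμ hW hW' hχ₀
  set ι : ℚ →+* ℂ := (Classical.arbitrary (InfinitePlace ℚ)).embedding with hι
  have hcard : Multiset.card (χ₀ ι) = 1 := card_eq_of_hasArchParameter' hχ₀ ι
  have e₀ := congrArg Multiset.sum (h 1 ℚ hcpt₁ τ χ₀ hχ₀ ι)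
  have c₀ := congrArg Multiset.card (h 1 ℚ hcpt₁ τ χ₀ hχ₀ ι)
  have e₁ := congrArg Multiset.sum (h 1 ℚ hcpt₁ τ' _ hχ₁ ι)
  simp only [Multiset.map_map, Function.comp_def, Multiset.card_map] at e₀ e₁ c₀
  rw [sum_map_neg_conj] at e₀
  rw [sum_map_add_const, sum_map_neg_conj_add_const, c₀, hcard] at e₁
  simp only [Nat.cast_one, one_mul, Complex.ofReal_one, map_one] at e₁
  have : (2 : ℂ) = 0 := by linear_combination e₁ - e₀
  norm_num at this

end Hermitian

/-! ### §12b The `GL(1)` case of the stub holds for EVERY datum (kernel-checked "why no n = 1 kill") -/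

section GLOne

open scoped ComplexConjugate Matrix
open NumberField.InfinitePlace NumberField.mixedEmbedding

variable {K : Type} [Field K] [NumberField K] {hcpt : isCompact_glFiniteIntegralLevel 1 K}

/-- The algebra behind the complex places: if `Re P = 2σ`, `Re Q = 0` then
`(P + iQ)/2 = -conj((P - iQ)/2) + 2σ`. [folklore] -/
theorem half_add_I_mul_eq {P Q : ℂ} {σ : ℝ} (hP : P.re = 2 * σ) (hQ : Q.re = 0) :
    (2 : ℂ)⁻¹ * (P + Complex.I * Q) =
      -(conj ((2 : ℂ)⁻¹ * (P + -Complex.I * Q))) + ((2 * σ : ℝ) : ℂ) := by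
  apply Complex.ext
  · simp [Complex.mul_re, Complex.mul_im, hQ]
    linarith [hP]
  · simp [Complex.mul_re, Complex.mul_im, hQ]

/-- Same with the roles of the two embeddings exchanged. [folklore] -/
theorem half_sub_I_mul_eq {P Q : ℂ} {σ : ℝ} (hP : P.re = 2 * σ) (hQ : Q.re = 0) :
    (2 : ℂ)⁻¹ * (P + -Complex.I * Q) =
      -(conj ((2 : ℂ)⁻¹ * (P + Complex.I * Q))) + ((2 * σ : ℝ) : ℂ) := by
  apply Complex.ext
  · simp [Complex.mul_re, Complex.mul_im, hQ]
    linarith [hP]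
  · simp [Complex.mul_re, Complex.mul_im, hQ]

/-- The algebra behind the real places: `Re R = σ ⇒ R = -R̄ + 2σ`. [folklore] -/
theorem eq_neg_conj_add_of_re_eq {R : ℂ} {σ : ℝ} (hR : R.re = σ) :
    R = -(conj R) + ((2 * σ : ℝ) : ℂ) := by
  apply Complex.ext
  · simp; linarith [hR]
  · simp

/-- **Hermitian symmetry of the archimedean parameter of EVERY automorphic datum on `GL₁(𝔸_K)`**:
if `π = W / W'` has archimedean parameter `χ`, then `χ(ῑ) = {-ā + 2σ : a ∈ χ(ι)}` at every embedding
`ι`, where `|θ_π| = ‖·‖^σ` for the Hecke character `θ_π` of `π`.  Proof: `𝔤𝔩₁(K_∞)` acts on the line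
`W/W'` through a real linear form `d` with `θ_π(det(exp Y, 1)) = e^{d(Y)}`
(`heckeCharacter_glOne_det_ofArch_expMem`) and `|θ_π(det(exp Y,1))| = ‖det(exp Y,1)‖^σ = e^{σ λ(Y)}`
(`exists_norm_apply_eq_ideleNorm_rpow`, `ideleNorm_det_ofInfinite_expGL_eq`), so `Re d = σ λ`; the
parameter is `{d(1_w)}` at a real place and `{½(d(1_w) ∓ i d(i_w))}` at `σ_w, σ̄_w`
(`archParameter_clauses_glOne`), and `Re d(1_w) = σ [K_w:ℝ]`, `Re d(i_w) = 0` finish.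
[cite: Clozel1990, Lemme 4.9] [cite: KnappVogan1995, Ch. IX §1 (p. 597)] -/
theorem hermitianSymmetry_glOne (π : AutomorphicRepData (AutomorphyDatum.gl 1 K hcpt))
    {χ : (K →+* ℂ) → Multiset ℂ} (hχ : π.HasArchParameter χ) :
    ∃ c : ℝ, ∀ ι : K →+* ℂ,
      χ (ComplexEmbedding.conjugate ι) = (χ ι).map fun a => -(starRingEnd ℂ a) + (c : ℂ) := by
  obtain ⟨θ, hθ⟩ := π.exists_heckeCharacter_glOne
  obtain ⟨σ, hσ⟩ := θ.exists_norm_apply_eq_ideleNorm_rpow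
  obtain ⟨ρ, hρ⟩ := π.exists_hasLieAction_gl
  obtain ⟨d, hd⟩ := π.exists_linearMap_lieAction_eq_smul_one_glOne ρ
  obtain ⟨hre, hco⟩ := π.archParameter_clauses_glOne hρ d hd hχ
  -- the link `θ(det (exp Y, 1)) = e^{d(Y)}`
  have hlink : ∀ Y : Matrix (Fin 1) (Fin 1) (mixedSpace K),
      ((θ (Matrix.GeneralLinearGroup.det (GLn.ofInfinite 1 K (expGL Y))) : ℂˣ) : ℂ) =
        Complex.exp (d ⟨Y, trivial⟩) := by
    intro Y
    have h := π.heckeCharacter_glOne_det_ofArch_expMem hθ ⟨Y, trivial⟩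
      (fun φ hφ => π.lieDeriv_sub_smul_mem_of_hasLieAction_glOne hρ hd ⟨Y, trivial⟩ hφ) 1
    rw [one_smul, Complex.ofReal_one, one_mul] at h
    exact h
  -- `Re d = σ λ`
  have hRe : ∀ Y : Matrix (Fin 1) (Fin 1) (mixedSpace K),
      (d ⟨Y, trivial⟩).re = σ * ((∑ w, Y.trace.1 w) + ∑ w, 2 * (Y.trace.2 w).re) := by
    intro Y
    have h1 := hσ (Matrix.GeneralLinearGroup.det (GLn.ofInfinite 1 K (expGL Y)))
    rw [hlink, Complex.norm_exp, ideleNorm_det_ofInfinite_expGL_eq, ← Real.exp_mul] at h1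
    have h2 := Real.exp_injective h1
    rw [h2]
    ring
  refine ⟨2 * σ, fun ι => ?_⟩
  rcases (mk ι).isReal_or_isComplex with hw | hw
  · -- real place
    have hι : ComplexEmbedding.IsReal ι := isReal_mk_iff.mp hw
    have e := hre ⟨mk ι, hw⟩
    dsimp only at e
    rw [embedding_mk_eq_of_isReal hι] at e
    rw [ComplexEmbedding.isReal_iff.mp hι, e, Multiset.map_singleton]
    congr 1
    have hR := hRe (realPlaceLie 1 ⟨mk ι, hw⟩ 1)
    rw [normExponent_realPlaceLie, Matrix.trace_one, Fintype.card_fin, Nat.cast_one, mul_one] at hR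
    exact eq_neg_conj_add_of_re_eq hR
  · -- complex place
    obtain ⟨w, hw'⟩ : ∃ w : {w : InfinitePlace K // w.IsComplex}, w.1 = mk ι := ⟨⟨mk ι, hw⟩, rfl⟩
    have hcard : (Fintype.card (ℂ →ₐ[ℝ] ℂ) : ℂ) = 2 := by
      rw [HCEmb.card_algHom_of_im_I (𝕜 := ℂ) (by simp)]
      norm_num
    have hIid : conj ((AlgHom.id ℝ ℂ) (RCLike.I : ℂ)) = -Complex.I := by simp
    have hIcj : conj ((Complex.conjAe : ℂ →ₐ[ℝ] ℂ) (RCLike.I : ℂ)) = Complex.I := by simp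
    -- the two values `p = ½(P - iQ)` at `σ_w` and `q = ½(P + iQ)` at `σ̄_w`
    have eid := hco w (AlgHom.id ℝ ℂ)
    have ecj := hco w (Complex.conjAe : ℂ →ₐ[ℝ] ℂ)
    rw [algHomId_toRingHom_comp] at eid
    rw [conjAe_toRingHom_comp] at ecj
    rw [HCEmb.proj_def, hcard, hIid] at eid
    rw [HCEmb.proj_def, hcard, hIcj] at ecj
    set P : ℂ := d ⟨complexPlaceLie 1 w ((1 : ℂ) • (1 : Matrix (Fin 1) (Fin 1) ℂ)), trivial⟩ with hPdef
    set Q : ℂ := d ⟨complexPlaceLie 1 w ((((RCLike.I : ℂ)) • (1 : ℂ)) • (1 : Matrix (Fin 1) (Fin 1) ℂ)),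
      trivial⟩ with hQdef
    -- `Re P = 2σ`, `Re Q = 0`
    have hP : P.re = 2 * σ := by
      have h : P.re = σ * ((∑ w', (complexPlaceLie 1 w ((1 : ℂ) • (1 : Matrix (Fin 1) (Fin 1) ℂ))).trace.1 w') +
          ∑ w', 2 * ((complexPlaceLie 1 w ((1 : ℂ) • (1 : Matrix (Fin 1) (Fin 1) ℂ))).trace.2 w').re) :=
        hRe _
      rw [normExponent_complexPlaceLie] at h
      have t1 : (Matrix.trace ((1 : ℂ) • (1 : Matrix (Fin 1) (Fin 1) ℂ))).re = 1 := by simp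
      rw [t1] at h
      rw [h]
      ring
    have hQ : Q.re = 0 := by
      have h : Q.re = σ * ((∑ w', (complexPlaceLie 1 w
            ((((RCLike.I : ℂ)) • (1 : ℂ)) • (1 : Matrix (Fin 1) (Fin 1) ℂ))).trace.1 w') +
          ∑ w', 2 * ((complexPlaceLie 1 w
            ((((RCLike.I : ℂ)) • (1 : ℂ)) • (1 : Matrix (Fin 1) (Fin 1) ℂ))).trace.2 w').re) :=
        hRe _
      rw [normExponent_complexPlaceLie] at h
      have tI : (Matrix.trace ((((RCLike.I : ℂ)) • (1 : ℂ)) • (1 : Matrix (Fin 1) (Fin 1) ℂ))).re = 0 := by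
        simp
      rw [tI] at h
      rw [h]
      ring
    have hwι : mk w.1.embedding = mk ι := (mk_embedding w.1).trans hw'
    rcases mk_eq_iff.mp hwι with h1 | h1
    · -- `ι = σ_w`
      subst h1
      rw [ecj, eid, Multiset.map_singleton]
      congr 1
      simp only [smul_eq_mul]
      exact half_add_I_mul_eq hP hQ
    · -- `ι = σ̄_w`
      subst h1
      have hcc : ComplexEmbedding.conjugate (ComplexEmbedding.conjugate w.1.embedding) = w.1.embedding :=
        star_star _
      rw [hcc, eid, ecj, Multiset.map_singleton]
      congr 1
      simp only [smul_eq_mul]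
      exact half_sub_I_mul_eq hP hQ


/-- **Corollary (parallel modulus exponent, unit-free)**: for every Borel–Jacquet datum on `GL₁(𝔸_K)`
with archimedean parameter `χ`, `Re(Σχ(ι) + Σχ(ῑ))` is the SAME real number `c` at every embedding
(`= 2σ`, `|θ_π| = ‖·‖^σ`; at a real `ι` this reads `2 Re a_ι = c`).  This is the archimedean shadow of
"the modulus of an idele class character is a power of the norm" — the uniformity-in-`w` that the
sibling cruxes `RegularTwistCM` / `HalfIntegralTwistCM` need for their exponent `N`, obtained here
without Dirichlet's unit theorem. [cite: WeilBNT1967, Ch. IV §4, Thm. 6] -/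
theorem archParameter_glOne_re_sum_eq (π : AutomorphicRepData (AutomorphyDatum.gl 1 K hcpt))
    {χ : (K →+* ℂ) → Multiset ℂ} (hχ : π.HasArchParameter χ) :
    ∃ c : ℝ, ∀ ι : K →+* ℂ, ((χ ι).sum + (χ (ComplexEmbedding.conjugate ι)).sum).re = c := by
  obtain ⟨c, hc⟩ := hermitianSymmetry_glOne π hχ
  refine ⟨c, fun ι => ?_⟩
  rw [hc ι, sum_map_neg_conj_add, card_eq_of_hasArchParameter' hχ ι]
  simp

/-- **The `GL(1)` case of `stub_hermitianSymmetry`, for EVERY cuspidal datum** (junk included: the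
tree's `π_log = span{log‖·‖, 1}/ℂ·1` as much as Hecke-character lines). [cite: Clozel1990, Lemme 4.9] -/
theorem hermitianSymmetry_cuspidal_glOne (π : CuspidalAutomorphicRepData 1 K hcpt)
    {χ : (K →+* ℂ) → Multiset ℂ} (hχ : π.1.HasArchParameter χ) :
    ∃ c : ℝ, ∀ ι : K →+* ℂ,
      χ (ComplexEmbedding.conjugate ι) = (χ ι).map fun a => -(starRingEnd ℂ a) + (c : ℂ) :=
  hermitianSymmetry_glOne π.1 hχ

end GLOne

end CycleThree

end Summit.Langlands.Langlands.Cruxes.RegularAdjointLiftCM.Disproof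

end
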